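import Literature.Analysis.FluidPDE.PassiveScalarForced
import Literature.Analysis.FluidPDE.PassiveScalarEnergyPointwise
import Literature.Analysis.FluidPDE.LongTimeAverageSlidingWindow
import Literature.Analysis.FluidPDE.SeisDissipationRateBoundProofs
import Literature.Analysis.FluidPDE.PassiveScalarReleaseExistence
import Literature.Analysis.FluidPDE.LerayHopfRestartTorus
import Literature.Analysis.FluidPDE.DoeringFoiasPowerProofs
import Literature.Analysis.FluidPDE.LerayHopfSpectralMeasurability
import Summits.AnomalousDissipation.AnomalousDissipation.Theses.LimitingAbsorption
import Summits.AnomalousDissipation.AnomalousDissipation.Theorems.RelaxingFamily.Negative.LinearEnstrophyBudget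
import Summits.AnomalousDissipation.AnomalousDissipation.Theorems.LimitingAbsorptionUniformRelaxationWitnessStubMeanEnergyGlue
import Summits.AnomalousDissipation.AnomalousDissipation.Theorems.TwodBoundedEnergyZeroMomentum.Negative.ShellPincer
import HarnessLib

/-! # Disproof of `UniformRelaxationWitness` (stmt-AnomalousDissipation-2937) — findings (v4)

Refuter seat `refuter-cdisprove-stmt-AnomalousDissipation-2937-0`, cycle 1 (2026-08-16). Crux:
`Summit.AnomalousDissipation.AnomalousDissipation.Theses.LimitingAbsorption.UniformRelaxationWitness`
(= thesis X: bounded-energy steadily forced planar Leray–Hopf family `v_j`, `ν_j → 0`, with (U_h) =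
phase-uniform `ν`-uniform exponential `L²` relaxation of ONE smooth profile `h`, and (ABS) = a `ν`-uniform
floor on the dissipation of the `h`-sourced scalar). Picked line: `Sketch` (one stub ⊋ crux). This file
is SELF-CONTAINED (Parts A–E are verbatim the Negative/ files listed, so that it elaborates whatever has
landed); everything is sorry-free except the NEAR-MISS section at the end.

VERDICT: **no kill; the crux resists — but the design space shrank and the gap is located.**

WHAT IS NOW A THEOREM (sorry-free below; filed under `Theorems/UniformRelaxationWitness/Negative/`):
(A) `h = 0` is dead ((ABS) sees the source: `longTimeAvgSup_dissipation_eq_zero_of_zero_source`); every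
    X-witness is a `RelaxingFamilyUnder` witness (`UniformRelaxationWitnessUnder.relaxingFamilyUnder`), so
    `¬RelaxingFamily → ¬X` and every refuted strengthening of crux r3 binds r2.
(B,C) SEIS ON THE DISSIPATION HORIZON: `seis_core_window` / `seis_rmk1_window` = the tree's discharge of
    Seis 2022 Rmk 1 with all hypotheses restricted to `(0, seisHorizon)`, `seisHorizon = (N+1)/D + 2`,
    `N = ⌈log(32C₀/a)⌉` — a function of the PROFILE data and the rate only. Consequence
    `relaxingFamily_false_with_tamePhases` (X forms in Part D): every witness has a window length `L*` with
    `sup_j inf_{s ≥ 0} ∫ₛ^{s+L*} ‖∇v_j‖₂ = ∞` — at suitable levels EVERY window of length `L*` is wild; NO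
    uniform-in-time energy hypothesis (finite-window energy bounds are automatic for Leray–Hopf drifts).
    Sub-classes killed: `WindowedStrainBudget` (one slope), `InitiallyTame` ("data must be pre-stirred":
    `j`-bounded strain on initial windows is dead, since (U_h) is demanded from phase 0), and
    `QuasiLaminarWindows` (windowed mean enstrophy bounded = planar dissipation `O(ν)`, Part D).
(D) SINGLE-SHELL FORCING IS DEAD for X and for r3 (`uniformRelaxationWitness_false_with_singleShell`,
    `relaxingFamily_false_with_singleShell`): good phases exist from `meanEnergy ≤ E` alone
    (`exists_goodPhase_energy`: honest Cesàro means, Doering–Foias, + a record argument), the landed pincer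
    `shellPincer_of_singleShell` turns them into a `j`-uniform windowed strain budget
    (`windowedStrainBudget_of_singleShell`), and (C) fires. The route's design rule "g must span ≥ 2
    shells" is now a checked theorem, data-free (restart at a good Leray–Hopf time).
(E) LINE `Sketch`: exact `T_j`-periodic states with pointwise energy ≤ E and `T_j ≤ T₀` need per-period
    mean strain → ∞ (`recurrentStates_false_without_unboundedPeriodStrain`); stub not misstated, crux-hard.
    Also the older receptacles: `¬XUnder {LinearEnstrophyBudget, BoundedEnstrophy, QuadraticEnstrophyBudget}`.
(F) DECAYING TURBULENCE IS DEAD: `g = 0` excluded for X and r3 (`uniformRelaxationWitness_false_with_zero_force`):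
    unforced levels have time-integrable enstrophy, hence quasi-laminar late windows (pigeonhole), and (D)'s
    `QuasiLaminarWindows` floor fires — the steady force of a witness is nonzero AND (D) spans ≥ 2 shells.
TYPED-LOOPHOLE AUDIT: no misstatement (weak class unique for bounded drift; all junk values of
`longTimeAvgSup` / `eScalarGradNormSq` / `scalarL2Sq` / `meanEnergy` hurt only a prover; `meanEnergy ≤ E`
IS contentful because Cesàro means of the energy are bounded per level, `timeMean_norm_sq_le`).

WHY IT RESISTS — the gap is one fractional power of a logarithm:
* The kill is EXACTLY a `ν`-uniform windowed strain bound (C) for every bounded-energy steadily forced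
  planar LH family. In `L²` currency the budgets are a power of `ν` short: `ν_j⟨‖∇v_j‖²⟩ ≤ ‖g‖E^{1/2}`,
  `⟨‖∇v_j‖²⟩ ≲ ν_j^{-1/2}` (Alexakis–Doering, palinstrophy `ν⟨‖Δv‖²⟩ ≤ ‖Δg‖E^{1/2}` + interpolation).
* BORDERLINE SQUEEZE (new): the vorticity `ω_j` solves a SOURCED advection–diffusion equation (source
  `curl g`, Pr = 1), so `ν`-UNIFORM windowed budgets exist at the `L¹` level — `‖ω(t)‖₁ ≤ ‖ω(s)‖₁ +
  (t-s)‖curl g‖₁` (L¹-contraction) and entropy budgets `∫Φ(ω)`, `Φ = LlogL`, with slope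
  `‖curl g‖_∞ log(e + ‖ω‖₁) = O(log(1/ν))` — exactly where Seis / Crippa–De Lellis floors STOP (`p > 1`,
  maximal function; `p = 1` is Bressan's open mixing-cost conjecture) and where Calderón–Zygmund `ω ↦ ∇v`
  loses; optimising `p - 1 ∼ 1/log(1/ν)` costs the logarithm gained. Every rigorous route meets the crux
  AT the logarithm, never beyond; Kraichnan–Batchelor predicts the truth is `log^{2/3}` below, unproved.
* Kinematics cannot decide: bounded `C^α` stirring relaxes uniformly (HCR 2025b), energy-constrained flows
  mix in finite time (LLNMD 2012); only NS budgets bite.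
LEARNINGS FOR PROVERS (from the disproof side): a witness must, at bounded energy, carry windowed strain
`≳ γ log(1/ν_j)` from EVERY phase at SOME level for each slope (C), with `g` on ≥ 2 shells (D), the
profile `h ≠ 0` (A), and — heuristically, by the L¹ budget — vorticity that is `L²`-large but `L¹`-moderate:
thin intense layers of area fraction `≲ 1/log²(1/ν)` (the ideators' "sign-coherent thin phases").

NEAR-MISSES (sorried at the end, with obstructions): `noUniversalRelaxer` (N1: needs the LH vorticity
equation in the weak scalar class), `preStirredData` (the `H¹ ∩ L²`-data form of `InitiallyTame`: needs the
pointwise 2-D enstrophy inequality with exact force term for LH solutions — the tree has it for Galerkin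
approximants, `steady_galerkin_enstrophy_le`, and only the dissipation part transferred; the STRAIN form
`uniformRelaxationWitness_false_with_initiallyTame` IS proved), the kill itself.
-/

noncomputable section

open MeasureTheory Set Filter Metric Function TopologicalSpace Topology
open scoped ENNReal NNReal Topology InnerProductSpace Convolution
open Literature.Analysis.FunctionSpaces Literature.Analysis.FunctionSpaces.Torus
open Literature.Analysis.SingularIntegrals Literature.Analysis.SingularIntegrals.Torus
open Literature.Analysis.FluidPDE Literature.Analysis.FluidPDE.Torus
open Summit.AnomalousDissipation.AnomalousDissipation.Theses.LimitingAbsorption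
open Summit.AnomalousDissipation.AnomalousDissipation.Theorems.RelaxingFamily.Negative
open Summit.AnomalousDissipation.AnomalousDissipation.Theorems.TwodBoundedEnergyZeroMomentum.Negative

-- D-0017: single-problem summit ⇒ `Summit.AnomalousDissipation.AnomalousDissipation.…` by design.
set_option linter.dupNamespace false

namespace Summit.AnomalousDissipation.AnomalousDissipation.Cruxes.UniformRelaxationWitness.Disproof

/-- The unit flat 2-torus (local notation). -/
local notation "𝕋²" => UnitAddTorus (Fin 2)
/-- Planar vectors (local notation). -/
local notation "E²" => EuclideanSpace ℝ (Fin 2)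

/-! # Part A — (ABS) sees the source; X-witnesses are `RelaxingFamily` witnesses; Seis floors (landed: `Negative/SeisTransfer.lean`, p98957) -/

/-! ## (ABS) sees the source: zero source and zero datum give zero mean dissipation -/

/-- An a.e. statement on a nondegenerate interval `(a, b)` has a witness in `(a, b)`. [folklore] -/
theorem exists_of_ae_Ioo {P : ℝ → Prop} {a b : ℝ} (hab : a < b)
    (h : ∀ᵐ t ∂(volume.restrict (Ioo a b)), P t) : ∃ t ∈ Ioo a b, P t := by
  have hne : (ae (volume.restrict (Ioo a b))).NeBot := by
    rw [ae_neBot, Ne, Measure.restrict_eq_zero, Real.volume_Ioo, ENNReal.ofReal_eq_zero, not_le]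
    linarith
  obtain ⟨t, ht, hP⟩ := ((ae_restrict_mem measurableSet_Ioo).and h).exists
  exact ⟨t, ht, hP⟩

/-- **Zero source, zero datum ⇒ zero cumulative dissipation on every horizon** (bounded drift,
`κ > 0`): the pointwise energy inequality `‖θ(t)‖² + 2κ∫₀ᵗ‖∇θ‖² ≤ ‖θ₀‖² = 0` at a good time
`t ∈ (T, T+1)`. [cite: DEIJ2022, (1.3)] -/
theorem lintegral_eScalarGradNormSq_eq_zero_of_zero_source {κ : ℝ} (hκ : 0 < κ)
    {u : ℝ → 𝕋² → E²}
    (hu : ∀ T : ℝ, 0 < T → MemLp (stLift u) ⊤ (volume.restrict (Ioo (0 : ℝ) T ×ˢ univ)))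
    {θ : ℝ → 𝕋² → ℝ} (hθ : IsWeakScalarTransportForced κ u (fun _ => 0) 0 θ) {T : ℝ} (hT : 0 < T) :
    ∫⁻ τ in Ioo 0 T, eScalarGradNormSq (θ τ) = 0 := by
  have hsol : IsWeakScalarTransportOn (T + 1) κ u 0 θ :=
    isWeakScalarTransportForcedOn_zero_iff.1 (hθ (T + 1) (by linarith))
  have hE := IsWeakScalarTransportOn.lintegral_sq_add_le_holds hκ hsol MemLp.zero
    (hu (T + 1) (by linarith))
  have hE' := ae_restrict_of_ae_restrict_of_subset (Ioo_subset_Ioo_left hT.le : Ioo T (T + 1) ⊆ _) hE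
  obtain ⟨t, ht, hle⟩ := exists_of_ae_Ioo (by linarith) hE'
  have hrhs : ∫⁻ x, ‖(0 : 𝕋² → ℝ) x‖ₑ ^ 2 = 0 := by simp
  have h2 : 2 * eScalarDissipation κ θ 0 t = 0 :=
    le_antisymm (le_add_self.trans (hle.trans hrhs.le)) zero_le
  have h3 : ∫⁻ τ in Ioo 0 t, eScalarGradNormSq (θ τ) = 0 := by
    unfold eScalarDissipation at h2
    rcases mul_eq_zero.1 h2 with h | h
    · exact absurd h two_ne_zero
    rcases mul_eq_zero.1 h with h' | h'
    · exact absurd h' (by rw [ENNReal.ofReal_eq_zero, not_le]; exact hκ)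
    · exact h'
  refine le_antisymm ?_ zero_le
  calc ∫⁻ τ in Ioo 0 T, eScalarGradNormSq (θ τ)
      ≤ ∫⁻ τ in Ioo 0 t, eScalarGradNormSq (θ τ) := lintegral_mono_set (Ioo_subset_Ioo_right ht.1.le)
    _ = 0 := h3

/-- **(ABS) sees the source.** For `κ > 0` and a drift `u` essentially bounded on every
`(0,T) × T²`, every global weak solution of `∂ₜθ + u·∇θ = κΔθ` with ZERO source from ZERO datum
has vanishing mean dissipation `longTimeAvgSup (t ↦ κ‖∇θ(t)‖²) = 0` (all Cesàro means vanish: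
the cumulative spectral dissipation is `0` on every horizon, and a nonnegative function below an
a.e.-null `ℝ≥0∞` function has Bochner integral `0`, measurable or not). Hence the absorbed-power
clause of the crux fails at every level when the profile is `h = 0`. [cite: DEIJ2022, (1.3)] -/
theorem longTimeAvgSup_dissipation_eq_zero_of_zero_source {κ : ℝ} (hκ : 0 < κ)
    {u : ℝ → 𝕋² → E²}
    (hu : ∀ T : ℝ, 0 < T → MemLp (stLift u) ⊤ (volume.restrict (Ioo (0 : ℝ) T ×ˢ univ)))
    {θ : ℝ → 𝕋² → ℝ} (hθ : IsWeakScalarTransportForced κ u (fun _ => 0) 0 θ) :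
    longTimeAvgSup (fun t => κ * (eScalarGradNormSq (θ t)).toReal) = 0 := by
  -- the Cesàro means vanish for `T > 0`
  have hmean : ∀ T : ℝ, 0 < T → timeMean (fun t => κ * (eScalarGradNormSq (θ t)).toReal) T = 0 := by
    intro T hT
    set F : ℝ → ℝ := fun t => (eScalarGradNormSq (θ t)).toReal with hF
    have hI : ∫ t in Ioc 0 T, F t = 0 := by
      have hFnn : 0 ≤ᵐ[volume.restrict (Ioc 0 T)] F :=
        Eventually.of_forall fun t => ENNReal.toReal_nonneg
      have hlin : ∫⁻ t in Ioc 0 T, ENNReal.ofReal (F t) = 0 := by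
        refine le_antisymm ?_ zero_le
        calc ∫⁻ t in Ioc 0 T, ENNReal.ofReal (F t)
            ≤ ∫⁻ t in Ioc 0 T, eScalarGradNormSq (θ t) :=
              lintegral_mono fun t => ENNReal.ofReal_toReal_le
          _ ≤ ∫⁻ t in Ioo 0 (T + 1), eScalarGradNormSq (θ t) :=
              lintegral_mono_set (Ioc_subset_Ioo_right (by linarith))
          _ = 0 := lintegral_eScalarGradNormSq_eq_zero_of_zero_source hκ hu hθ (by linarith)
      by_cases hFm : AEStronglyMeasurable F (volume.restrict (Ioc 0 T))
      · rw [integral_eq_lintegral_of_nonneg_ae hFnn hFm, hlin, ENNReal.toReal_zero]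
      · exact integral_non_aestronglyMeasurable hFm
    unfold timeMean
    rw [intervalIntegral.integral_of_le hT.le, integral_const_mul]
    change T⁻¹ * (κ * ∫ t in Ioc 0 T, F t) = 0
    rw [hI, mul_zero, mul_zero]
  -- hence the `limsup` is that of the zero function
  unfold longTimeAvgSup
  have hev : timeMean (fun t => κ * (eScalarGradNormSq (θ t)).toReal) =ᶠ[atTop] fun _ => (0 : ℝ) :=
    (eventually_gt_atTop 0).mono fun T hT => hmean T hT
  rw [Filter.limsup_congr hev, Filter.limsup_const]

/-! ## The crux with an extra hypothesis on the witness -/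

/-- The crux `UniformRelaxationWitness` (thesis X) with an EXTRA hypothesis `Hyp g h ν v` on the
witness — the shape of refuted strengthenings, parallel to `RelaxingFamily.Negative.RelaxingFamilyUnder`
(`¬ UniformRelaxationWitnessUnder Hyp` reads "any witness of X leaves the class `Hyp`"). -/
def UniformRelaxationWitnessUnder
    (Hyp : (𝕋² → E²) → (𝕋² → ℝ) → (ℕ → ℝ) → (ℕ → ℝ → 𝕋² → E²) → Prop) : Prop :=
  ∃ (g : 𝕋² → E²) (h : 𝕋² → ℝ), IsSmooth g ∧ IsDivFree g ∧ HasZeroMean g ∧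
    IsSmooth h ∧ HasZeroMean h ∧
    ∃ (ν : ℕ → ℝ) (v₀ : ℕ → 𝕋² → E²) (v : ℕ → ℝ → 𝕋² → E²),
      (∀ j, 0 < ν j) ∧ Tendsto ν atTop (𝓝 0) ∧
      (∀ j, IsGlobalLerayHopf (ν j) (fun _ => g) (v₀ j) (v j)) ∧
      (∀ j (T : ℝ), 0 < T →
        MemLp (stLift (v j)) ⊤ (volume.restrict (Ioo (0 : ℝ) T ×ˢ univ))) ∧
      (∃ E : ℝ, ∀ j, meanEnergy (v j) ≤ E) ∧
      Hyp g h ν v ∧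
      (∃ C γ : ℝ, 0 ≤ C ∧ 0 < γ ∧ RelaxesUniformly ν v h C γ) ∧
      ∃ ε : ℝ, 0 < ε ∧ ∀ j : ℕ, ∃ θ : ℝ → 𝕋² → ℝ,
        IsWeakScalarTransportForced (ν j) (v j) (fun _ => h) 0 θ ∧
        ε ≤ longTimeAvgSup (fun t => ν j * (eScalarGradNormSq (θ t)).toReal)

/-- Sanity: with the trivial extra hypothesis `UniformRelaxationWitnessUnder` is the crux itself. [folklore] -/
theorem uniformRelaxationWitnessUnder_true_iff :
    UniformRelaxationWitnessUnder (fun _ _ _ _ => True) ↔ UniformRelaxationWitness := by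
  unfold UniformRelaxationWitnessUnder RelaxesUniformly UniformRelaxationWitness
  simp only [true_and]

/-- Monotonicity of `UniformRelaxationWitnessUnder` in the extra hypothesis. [folklore] -/
theorem UniformRelaxationWitnessUnder.mono
    {H₁ H₂ : (𝕋² → E²) → (𝕋² → ℝ) → (ℕ → ℝ) → (ℕ → ℝ → 𝕋² → E²) → Prop}
    (h12 : ∀ g h ν v, H₁ g h ν v → H₂ g h ν v) (h1 : UniformRelaxationWitnessUnder H₁) :
    UniformRelaxationWitnessUnder H₂ := by
  obtain ⟨g, h, hg, hgd, hgm, hh, hhm, ν, v₀, v, hν, hνlim, hLH, hbd, hE, hH, hrest⟩ := h1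
  exact ⟨g, h, hg, hgd, hgm, hh, hhm, ν, v₀, v, hν, hνlim, hLH, hbd, hE, h12 _ _ _ _ hH, hrest⟩

/-! ## The profile of a witness is nonzero: X-witnesses are `RelaxingFamily`-witnesses -/

/-- **A witness of X has `h ≠ 0` and is a witness of `RelaxingFamilyUnder` with the same extra
hypothesis.** If `h = 0`, the (ABS) clause at level `0` asks for `ε ≤ ⟨ν₀‖∇θ‖²⟩` along a global
weak solution with zero source and zero datum into the bounded drift `v₀`, whose mean dissipation
vanishes (`longTimeAvgSup_dissipation_eq_zero_of_zero_source`) — contradicting `ε > 0`. [folklore] -/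
theorem UniformRelaxationWitnessUnder.relaxingFamilyUnder
    {H : (𝕋² → E²) → (𝕋² → ℝ) → (ℕ → ℝ) → (ℕ → ℝ → 𝕋² → E²) → Prop}
    (hX : UniformRelaxationWitnessUnder H) : RelaxingFamilyUnder H := by
  obtain ⟨g, h, hg, hgd, hgm, hh, hhm, ν, v₀, v, hν, hνlim, hLH, hbd, hE, hH, hU, ε, hε, habs⟩ := hX
  refine ⟨g, h, hg, hgd, hgm, hh, hhm, ?_, ν, v₀, v, hν, hνlim, hLH, hbd, hE, hH, hU⟩
  rintro rfl
  obtain ⟨θ, hθ, hεle⟩ := habs 0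
  rw [longTimeAvgSup_dissipation_eq_zero_of_zero_source (hν 0) (hbd 0) hθ] at hεle
  exact absurd hεle (not_le.2 hε)

/-! ## Corollaries: the negative knowledge of `RelaxingFamily` binds the crux -/

/-- **A refutation of crux r3 kills r2**: `¬ RelaxingFamily → ¬ UniformRelaxationWitness`
(the profile of an X-witness is nonzero, so its (U_h) half is a `RelaxingFamily` witness). [folklore] -/
theorem uniformRelaxationWitness_false_of_not_relaxingFamily (hR : ¬ RelaxingFamily) :
    ¬ UniformRelaxationWitness := fun hX =>
  hR (uniformRelaxationWitnessUnder_true_iff.2 hX).relaxingFamilyUnder.relaxingFamily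

/-- **The degenerate profile is excluded**: no witness of X has `h = 0`. [folklore] -/
theorem uniformRelaxationWitness_false_with_zero_profile :
    ¬ UniformRelaxationWitnessUnder (fun _ h _ _ => h = 0) := fun hX => by
  obtain ⟨_, h, -, -, -, -, -, hh0, _, _, _, -, -, -, -, -, hH, -⟩ := hX.relaxingFamilyUnder
  exact hh0 hH

/-- **X is false without super-linear enstrophy growth** (Seis' floor, unconditional): no witness
of `UniformRelaxationWitness` admits a `j`-uniform linear windowed budget
`∫₀ᵗ ‖∇v_j(s_j + τ)‖_{L²} dτ ≤ M (1 + t)` (with essentially bounded energy) from some phase `s_j` on.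
[cite: Seis2022, Thm 2 and Remark 1 (arXiv:2003.08794 pp. 3–4)] -/
theorem uniformRelaxationWitness_false_without_superlinearEnstrophy :
    ¬ UniformRelaxationWitnessUnder LinearEnstrophyBudget := fun hX =>
  relaxingFamily_false_without_superlinearEnstrophy hX.relaxingFamilyUnder

/-- **X is false without unbounded enstrophy**: no witness of `UniformRelaxationWitness` has
`j`-uniformly (essentially) bounded enstrophy `‖∇v_j(s_j + t)‖²_{L²} ≤ Z` from some phase on — no
stirring, Galilean drifts, laminar and condensate states, `H¹`-convergent families are all excluded.
[cite: Seis2022, Thm 2 (arXiv:2003.08794 pp. 3–4)] -/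
theorem uniformRelaxationWitness_false_without_unboundedEnstrophy :
    ¬ UniformRelaxationWitnessUnder BoundedEnstrophy := fun hX =>
  relaxingFamily_false_without_unboundedEnstrophy hX.relaxingFamilyUnder

/-- **X is false without super-linear growth of the windowed MEAN enstrophy**: no witness of
`UniformRelaxationWitness` has `∫₀ᵗ ‖∇v_j(s_j + τ)‖²_{L²} dτ ≤ Z (1 + t)` with one `Z` from some phase
on — the receptacle of every `ν`-uniform time-averaged enstrophy bound (single-shell forcing:
`⟨‖∇v‖²⟩ ≤ 4π² m E` by the ShellPincer bound; band-limited Galerkin stirring). By the planar energy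
balance `ν_j⟨‖∇v_j‖²⟩ = ⟨⟨g, v_j⟩⟩ ≤ ‖g‖₂ E^{1/2}` only `Z_j ≲ ν_j^{-1}` (Alexakis–Doering: `ν_j^{-1/2}`)
is available in general, so this does not refute the crux: a kill is exactly a `ν`-uniform
`o(log²(1/ν))` windowed enstrophy bound for bounded-energy steadily forced planar Navier–Stokes.
[cite: Seis2022, Remark 1 (arXiv:2003.08794 p. 4)] -/
theorem uniformRelaxationWitness_false_without_superlinearMeanEnstrophy :
    ¬ UniformRelaxationWitnessUnder QuadraticEnstrophyBudget := fun hX =>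
  relaxingFamily_false_without_superlinearMeanEnstrophy hX.relaxingFamilyUnder

/-! # Part B — windowed Seis core (landed: `Negative/SeisWindowCore.lean`, p101714) -/

variable {d : Type*} [Fintype d] [DecidableEq d]


/-! ## The windowed core (verbatim `seis_core` with restricted hypotheses) -/

set_option maxHeartbeats 800000 in
/-- **Windowed core of Seis 2022, Thm. 2 / Rmk. 1** (`p = q = r = 2`, `δ² = κ`, `0 < D`): the
estimate of `Literature.Analysis.FluidPDE.seis_core` with every hypothesis on the drift, the weak
solution and the decay restricted to the dissipation horizon `(0, T)`, `T = (N+1)/D + 2` — which is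
all the printed proof (and the tree's) ever uses. Proof: verbatim the tree's `seis_core` (Seis 2022
§2.2: Lemma 4 at `ρ₀ = θ₀ ⋆ k_δ`, the chain of slice increments over good times, the brutal estimate
at a good time `τ ∈ [N/D, N/D+1]`), with the four global hypotheses replaced by their restrictions.
[cite: Seis2022, proof of Thm 2, §2.2 (pp. 7–8)] -/
theorem seis_core_window {a B C₀ M Mv : ℝ} (ha : 0 < a) (hB : 0 ≤ B) (hC₀ : 0 < C₀) (hM : 0 ≤ M)
    (hMv : 0 ≤ Mv) {κ D : ℝ} {u : ℝ → UnitAddTorus d → EuclideanSpace ℝ d} {θ₀ : UnitAddTorus d → ℝ}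
    {θ : ℝ → UnitAddTorus d → ℝ} (hD : 0 < D) {δ : ℝ} (hδ : 0 < δ)
    (hκδ : κ = δ ^ 2) (hδ4 : δ ≤ 1 / 4) (hδa : δ ≤ a / (2 * seisMod d B)) (N : ℕ)
    (hu2 : ∀ᵐ t ∂((volume : Measure ℝ).restrict (Ioo 0 (((N : ℝ) + 1) / D + 2))),
      ∫⁻ x, ‖u t x‖ₑ ^ 2 ≤ ENNReal.ofReal Mv)
    (hgrad : ∫⁻ τ in Ioo 0 (((N : ℝ) + 1) / D + 2), eGradNormSq (u τ) ^ (1 / 2 : ℝ) ≤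
      ENNReal.ofReal (M * (1 + (((N : ℝ) + 1) / D + 2))))
    (hθ₀ : IsSmooth θ₀) (hθ₀0 : ∫ x, θ₀ x = 0) (ha' : a ≤ ∫ x, |θ₀ x|)
    (hB' : ∫ x, ‖Torus.gradient θ₀ x‖ ≤ B)
    (hsol : Torus.IsWeakScalarTransportOn (((N : ℝ) + 1) / D + 2) κ u θ₀ θ)
    (hdecay : ∀ᵐ t ∂((volume : Measure ℝ).restrict (Ioo 0 (((N : ℝ) + 1) / D + 2))),
      Torus.scalarL2Sq (θ t) ≤ (C₀ * Real.exp (-(D * t))) ^ 2) :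
    a / 16 * Real.log (1 + min (a / 2 / seisMod d B) 1 / (lemma4Const d * δ)) -
        Real.log (1 + 1 / (2 * δ)) * (C₀ * Real.exp (-(N : ℝ))) ≤
      seisE2 d C₀ M * (1 + (((N : ℝ) + 1) / D + 2)) + 1 := by
  classical
  -- the kernel and the reference density
  have hk : IsSmooth (kernel (d := d) δ) := isSmooth_kernel hδ hδ4
  have hkc : Continuous (kernel (d := d) δ) := continuous_kernel hδ hδ4
  have hki : Integrable (kernel (d := d) δ) volume := hkc.integrable_unitAddTorus
  have hθ₀i : Integrable θ₀ volume := hθ₀.integrable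
  have hg : 0 < seisMod d B := seisMod_pos d hB
  set n : ℝ := (Fintype.card d : ℝ) with hn
  set CT := seisCT d with hCT
  set c₂ := seisC2 d with hc₂
  set E₂ := seisE2 d C₀ M with hE₂
  have hCT0 : 0 ≤ CT := seisCT_nonneg d
  have hc₂0 : 0 ≤ c₂ := seisC2_nonneg d
  set L₀ := Real.log (1 + 1 / (2 * δ)) with hL₀
  have hL₀0 : 0 ≤ L₀ := log_one_add_inv_two_mul_nonneg hδ
  -- mean zero and norms of mollifications
  have hmean_conv : ∀ {f : UnitAddTorus d → ℝ}, Integrable f volume → ∫ x, f x = 0 →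
      ∫ x, (f ⋆ kernel δ) x = 0 := fun {f} hf hf0 => by
    rw [integral_convolution (L := ContinuousLinearMap.lsmul ℝ ℝ) hf hki]
    simp [hf0]
  set ρ₀ : UnitAddTorus d → ℝ := θ₀ ⋆ kernel δ with hρ₀
  have hρ₀c : Continuous ρ₀ := continuous_convolution hθ₀i hkc
  have hρ₀i : Integrable ρ₀ volume := hρ₀c.integrable_unitAddTorus
  have hρ₀0 : ∫ x, ρ₀ x = 0 := hmean_conv hθ₀i hθ₀0
  -- time horizon
  set T : ℝ := (((N : ℝ) + 1) / D + 2) with hT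
  have hNDpos : 0 ≤ ((N : ℝ) + 1) / D := by positivity
  have hT1 : 1 ≤ T := by linarith
  have hT0 : 0 < T := by linarith
  have hinvD : 0 ≤ (1 : ℝ) / D := by positivity
  have hND : (N : ℝ) / D + 1 ≤ T := by
    have e : T = (N : ℝ) / D + 1 / D + 2 := by rw [hT, add_div]
    rw [e]; linarith
  have hsolT := hsol
  -- the enstrophy rate `G`
  set Ge : ℝ → ℝ≥0∞ := fun t => eGradNormSq (u t) ^ (1 / 2 : ℝ) with hGe
  have hGem : AEMeasurable Ge ((volume : Measure ℝ).restrict (Ioo 0 T)) :=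
    (aemeasurable_eGradNormSq_slice hsolT.aestronglyMeasurable_uncurry_velocity).pow_const _
  have hGfin : ∫⁻ t in Ioo 0 T, Ge t ≠ ∞ := (lt_of_le_of_lt hgrad ENNReal.ofReal_lt_top).ne
  set G : ℝ → ℝ := fun t => (Ge t).toReal with hG
  have hGi : IntegrableOn G (Ioo 0 T) := integrable_toReal_of_lintegral_ne_top hGem hGfin
  have hG0 : ∀ t, 0 ≤ G t := fun t => ENNReal.toReal_nonneg
  have hGint : ∫ t in Ioo 0 T, G t ≤ M * (1 + T) := by
    rw [hG, integral_toReal hGem (ae_lt_top' hGem hGfin)]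
    exact ENNReal.toReal_le_of_le_ofReal (by positivity) hgrad
  have hGsqrt : ∀ t, Real.sqrt (eGradNormSq (u t)).toReal = G t := fun t => sqrt_toReal_eq _
  -- the flux bound
  obtain ⟨bound, hbi, hbd⟩ := hsolT.exists_flux_bound₁ hk
  have hbd' : ∀ᵐ σ ∂((volume : Measure ℝ).restrict (Ioo 0 T)), ∀ x,
      ‖sliceFlux δ κ (θ σ) (u σ) x‖ ≤ bound σ := hbd
  have hflmT : AEStronglyMeasurable (uncurry fun σ x => sliceFlux δ κ (θ σ) (u σ) x)
      (((volume : Measure ℝ).restrict (Ioo 0 T)).prod volume) := hsolT.aestronglyMeasurable_uncurry_flux₁ hk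
  have hflxi : ∀ x, IntegrableOn (fun σ => sliceFlux δ κ (θ σ) (u σ) x) (Ioo 0 T) := fun x =>
    (hsolT.integrable_mul_flux hk x).integral_prod_left
  -- the good set
  set S : Set ℝ := {t | t ∈ Ioo 0 T ∧
    (∀ x, (θ t ⋆ kernel δ) x = ρ₀ x + ∫ σ in Ioc 0 t, sliceFlux δ κ (θ σ) (u σ) x) ∧
    ∫ x, θ t x = 0 ∧ MemLp (θ t) 2 volume ∧ Integrable (θ t) volume ∧ AEStronglyMeasurable (u t) volume ∧
    Integrable (fun y => ‖u t y‖ * θ t y) volume ∧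
    Torus.scalarL2Sq (θ t) ≤ (C₀ * Real.exp (-(D * t))) ^ 2 ∧
    (∫⁻ x, ‖u t x‖ₑ ^ 2 ≤ ENNReal.ofReal Mv) ∧ Ge t < ∞} with hS
  have hSae : ∀ᵐ t ∂((volume : Measure ℝ).restrict (Ioo 0 T)), t ∈ S := by
    filter_upwards [ae_restrict_mem measurableSet_Ioo, ae_seis_good hsolT hθ₀i hθ₀0 hδ hδ4,
      hdecay, hu2, ae_lt_top' hGem hGfin]
      with t ht hgood hdec hu hG
    exact ⟨ht, hgood.1, hgood.2.1, hgood.2.2.1, hgood.2.2.2.1, hgood.2.2.2.2.1, hgood.2.2.2.2.2, hdec, hu, hG⟩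
  -- facts at good times
  have hS_sq : ∀ {t}, t ∈ S → Real.sqrt (∫ x, θ t x ^ 2) ≤ C₀ := fun {t} ht => by
    have h1 : Real.sqrt (∫ x, θ t x ^ 2) ≤ C₀ * Real.exp (-(D * t)) := by
      rw [← Real.sqrt_sq (by positivity : 0 ≤ C₀ * Real.exp (-(D * t)))]
      exact Real.sqrt_le_sqrt ht.2.2.2.2.2.2.2.1
    refine h1.trans (mul_le_of_le_one_right hC₀.le ?_)
    exact Real.exp_le_one_iff.2 (by nlinarith [ht.1.1, hD])
  have hS_conv_c : ∀ {t}, t ∈ S → Continuous (θ t ⋆ kernel δ) := fun {t} ht => continuous_convolution ht.2.2.2.2.1 hkc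
  have hS_conv0 : ∀ {t}, t ∈ S → ∫ x, (θ t ⋆ kernel δ) x = 0 := fun {t} ht => hmean_conv ht.2.2.2.2.1 ht.2.2.1
  have hS_u2 : ∀ {t}, t ∈ S → MemLp (u t) 2 volume := fun {t} ht => memLp_two_of_lintegral_sq_le ht.2.2.2.2.2.1 ht.2.2.2.2.2.2.2.2.1
  have hS_eG : ∀ {t}, t ∈ S → eGradNormSq (u t) ≠ ∞ := fun {t} ht => by
    have h := ht.2.2.2.2.2.2.2.2.2
    simp only [hGe] at h
    exact (ENNReal.rpow_lt_top_iff_of_pos (by norm_num : (0 : ℝ) < 1 / 2)).1 h |>.ne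
  -- differences of mollified slices are flux integrals
  have hdiff : ∀ {s t : ℝ}, (s = 0 ∨ s ∈ S) → t ∈ S → s ≤ t → ∀ x,
      (θ t ⋆ kernel δ) x - (if s = 0 then ρ₀ x else (θ s ⋆ kernel δ) x) =
        ∫ σ in Ioc s t, sliceFlux δ κ (θ σ) (u σ) x := by
    intro s t hs ht hst x
    rcases hs with rfl | hs
    · simp only [if_true]
      rw [ht.2.1 x]; ring
    · have hs0 : s ≠ 0 := ne_of_gt hs.1.1
      rw [if_neg hs0, ht.2.1 x, hs.2.1 x]
      have hun : Ioc 0 t = Ioc 0 s ∪ Ioc s t := (Ioc_union_Ioc_eq_Ioc hs.1.1.le hst).symm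
      have hIt : IntegrableOn (fun σ => sliceFlux δ κ (θ σ) (u σ) x) (Ioc 0 t) :=
        (hflxi x).mono_set (Ioc_subset_Ioo_right ht.1.2)
      rw [hun, setIntegral_union (Ioc_disjoint_Ioc_of_le le_rfl) measurableSet_Ioc
        (hIt.mono_set (Ioc_subset_Ioc_right hst)) (hIt.mono_set (Ioc_subset_Ioc_left hs.1.1.le))]
      ring
  -- sup bound of flux integrals over short intervals: absolute continuity of `∫ bound`
  set Q : ℝ := δ⁻¹ * Real.sqrt Mv * T + L₀ + 1 with hQ
  have hQ0 : 0 < Q := by positivity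
  set η : ℝ := 1 / (2 * Q) with hη
  have hη0 : 0 < η := by positivity
  have hηQ : Q * η = 1 / 2 := by rw [hη]; field_simp
  obtain ⟨δ', hδ'0, hδ'⟩ := exists_pos_setLIntegral_lt_of_measure_lt
    (μ := (volume : Measure ℝ).restrict (Ioo 0 T)) (f := fun t => ‖bound t‖ₑ) hbi.2.ne
    (ENNReal.ofReal_pos.2 hη0).ne'
  set δ₁ : ℝ≥0∞ := min δ' 1 with hδ₁
  have hδ₁0 : δ₁ ≠ 0 := (lt_min hδ'0 zero_lt_one).ne'
  have hδ₁t : δ₁ ≠ ∞ := ne_top_of_le_ne_top ENNReal.one_ne_top (min_le_right _ _)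
  set h : ℝ := δ₁.toReal / 2 with hh
  have hh0 : 0 < h := by have := ENNReal.toReal_pos hδ₁0 hδ₁t; rw [hh]; linarith
  -- `∫_{(s,t]} bound ≤ η` for `(s,t] ⊆ (0,T)` of length `≤ h`
  have hshort : ∀ {s t : ℝ}, 0 ≤ s → s ≤ t → t < T → t - s ≤ h → ∫ σ in Ioc s t, bound σ ≤ η := by
    intro s t hs0 hst htT hts
    have hsub : Ioc s t ⊆ Ioo 0 T := fun σ hσ => ⟨hs0.trans_lt hσ.1, hσ.2.trans_lt htT⟩
    have hmeas : ((volume : Measure ℝ).restrict (Ioo 0 T)) (Ioc s t) < δ' := by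
      rw [Measure.restrict_apply measurableSet_Ioc, Set.inter_eq_self_of_subset_left hsub, Real.volume_Ioc]
      calc ENNReal.ofReal (t - s) ≤ ENNReal.ofReal h := ENNReal.ofReal_le_ofReal hts
        _ < δ₁ := by
            refine (ENNReal.ofReal_lt_iff_lt_toReal hh0.le hδ₁t).2 ?_
            rw [hh]; linarith [ENNReal.toReal_pos hδ₁0 hδ₁t]
        _ ≤ δ' := min_le_left _ _
    have hlt := hδ' (Ioc s t) hmeas
    rw [Measure.restrict_restrict_of_subset hsub] at hlt
    have hbi' : IntegrableOn bound (Ioc s t) := hbi.mono_set hsub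
    calc ∫ σ in Ioc s t, bound σ ≤ ∫ σ in Ioc s t, ‖bound σ‖ := integral_mono hbi' hbi'.norm fun σ => Real.le_norm_self _
      _ = (∫⁻ σ in Ioc s t, ‖bound σ‖ₑ).toReal := integral_norm_eq_lintegral_enorm hbi'.aestronglyMeasurable
      _ ≤ (ENNReal.ofReal η).toReal := ENNReal.toReal_mono ENNReal.ofReal_ne_top hlt.le
      _ = η := ENNReal.toReal_ofReal hη0.le
  -- flux integrals over short good intervals are `≤ η` pointwise
  have hflux_small : ∀ {s σ : ℝ}, 0 ≤ s → s ≤ σ → σ < T → σ - s ≤ h → ∀ x,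
      |∫ r in Ioc s σ, sliceFlux δ κ (θ r) (u r) x| ≤ η := by
    intro s σ hs0 hsσ hσT hσs x
    have hsub : Ioc s σ ⊆ Ioo 0 T := fun r hr => ⟨hs0.trans_lt hr.1, hr.2.trans_lt hσT⟩
    refine le_trans ?_ (hshort hs0 hsσ hσT hσs)
    rw [← Real.norm_eq_abs]
    exact norm_integral_le_of_norm_le (hbi.mono_set hsub)
      ((ae_restrict_of_ae_restrict_of_subset hsub hbd').mono fun r hr => hr x)
  -- a good time `τ ∈ [N/D, N/D+1)` and a good time `s₁ ≤ min h τ`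
  have hND0 : 0 ≤ (N : ℝ) / D := by positivity
  obtain ⟨τ, hτS, hτI⟩ := exists_mem_of_ae_mem hSae hND0 (by linarith : (N : ℝ) / D < (N : ℝ) / D + 1) hND
  have hτ0 : 0 < τ := hτS.1.1
  have hτT : τ < T := hτS.1.2
  obtain ⟨s₁, hs₁S, hs₁I⟩ := exists_mem_of_ae_mem hSae le_rfl (lt_min hh0 hτ0)
    ((min_le_right _ _).trans hτT.le)
  have hs₁0 : 0 < s₁ := hs₁S.1.1
  have hs₁h : s₁ ≤ h := (hs₁I.2.trans_le (min_le_left _ _)).le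
  have hs₁τ : s₁ < τ := hs₁I.2.trans_le (min_le_right _ _)
  -- the chain of good times from `s₁` to `τ`
  obtain ⟨J, p, hJ, hp0, hpJ, hmono, hpS, hgap⟩ := exists_chain_mem hSae hs₁S hs₁0 hτS hs₁τ hτT hh0
  set Φ : ℝ → ℝ := fun t => krLogDist δ (θ t ⋆ kernel δ) with hΦ
  set m : ℝ → ℝ := fun σ => C₀ * (CT + Real.sqrt n) * G σ + c₂ * C₀ with hm
  set c : ℝ := δ⁻¹ * η * Real.sqrt Mv with hc
  have hmono' : ∀ i j, i ≤ j → j ≤ J → p i ≤ p j := by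
    intro i j hij hjJ
    induction j with
    | zero => simp [Nat.le_zero.1 hij]
    | succ j ih =>
      rcases Nat.lt_or_ge i (j + 1) with hlt | hge
      · exact (ih (Nat.lt_succ_iff.1 hlt) (Nat.le_of_succ_le hjJ)).trans (hmono j (Nat.lt_of_succ_le hjJ)).le
      · rw [le_antisymm hij hge]
  have hpT : ∀ j, j ≤ J → p j < T := fun j hj => (hpS j hj).1.2
  have hp0' : ∀ j, j ≤ J → 0 < p j := fun j hj => (hpS j hj).1.1
  -- the increments
  have hinc : ∀ j, j < J → Φ (p j) - Φ (p (j + 1)) ≤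
      (∫ σ in Ioc (p j) (p (j + 1)), m σ) + c * (p (j + 1) - p j) := by
    intro j hj
    have hsS := hpS j hj.le
    have htS := hpS (j + 1) (Nat.succ_le_of_lt hj)
    have hst : p j ≤ p (j + 1) := (hmono j hj).le
    have hsub : Ioc (p j) (p (j + 1)) ⊆ Ioo 0 T := fun σ hσ => ⟨(hp0' j hj.le).trans hσ.1, hσ.2.trans_lt (hpT _ (Nat.succ_le_of_lt hj))⟩
    have hkey := krLogDist_sub_le_seis (d := d) hδ hδ4 hκδ (C₀ := C₀) (Mv := Mv) (S₀ := η) hMv hη0.le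
      ((hS_conv_c hsS).memLp_of_hasCompactSupport (HasCompactSupport.of_compactSpace _)) (hS_conv_c hsS)
      (hS_conv0 hsS) ((sqrt_integral_sq_convolution_kernel_le hsS.2.2.2.1 hδ hδ4).trans (hS_sq hsS))
      (hS_conv_c htS).integrable_unitAddTorus (hS_conv0 htS)
      (fun x => by simpa [ne_of_gt hsS.1.1] using hdiff (Or.inr hsS) htS hst x)
      (hflmT.mono_measure (Measure.prod_mono (Measure.restrict_mono hsub le_rfl) le_rfl))
      (ae_restrict_of_ae_restrict_of_subset hsub hbd') (hbi.mono_set hsub) ?_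
      ((hGi.mono_set hsub).congr (Eventually.of_forall fun σ => (hGsqrt σ).symm))
    · -- conclude from `hkey`
      have hmi : IntegrableOn m (Ioc (p j) (p (j + 1))) :=
        (((hGi.mono_set hsub).const_mul _).add (integrableOn_const measure_Ioc_lt_top.ne))
      have e : ∫ σ in Ioc (p j) (p (j + 1)), (C₀ * (seisCT d + Real.sqrt (Fintype.card d)) *
          Real.sqrt (eGradNormSq (u σ)).toReal + (seisC2 d * C₀ + δ⁻¹ * η * Real.sqrt Mv)) =
          (∫ σ in Ioc (p j) (p (j + 1)), m σ) + c * (p (j + 1) - p j) := by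
        have e1 : ∀ σ, C₀ * (seisCT d + Real.sqrt (Fintype.card d)) * Real.sqrt (eGradNormSq (u σ)).toReal +
            (seisC2 d * C₀ + δ⁻¹ * η * Real.sqrt Mv) = m σ + c := fun σ => by
          simp only [hm, hc, hGsqrt, hCT, hc₂, hn]; ring
        simp_rw [e1]
        rw [integral_add hmi (integrableOn_const measure_Ioc_lt_top.ne), setIntegral_const,
          Real.volume_real_Ioc_of_le hst, smul_eq_mul, mul_comm]
      rw [e] at hkey
      exact hkey
    · -- the slice facts on `(p j, p (j+1)]`
      filter_upwards [ae_restrict_mem measurableSet_Ioc,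
        ae_restrict_of_ae_restrict_of_subset hsub hSae] with σ hσI hσS
      refine ⟨hσS.2.2.2.1, hS_sq hσS, hS_u2 hσS, hσS.2.2.2.2.2.2.2.2.1, hS_eG hσS, fun x => ?_⟩
      have e := hdiff (Or.inr hsS) hσS hσI.1.le x
      simp only [ne_of_gt hsS.1.1, if_false] at e
      rw [e]
      exact hflux_small (hp0' j hj.le).le hσI.1.le hσS.1.2 (by linarith [hσI.2, hgap j hj]) x
  -- the chain estimate `Φ s₁ - Φ τ ≤ ∫_{(s₁,τ]} m + c (τ - s₁)`
  have hsub1 : Ioc s₁ τ ⊆ Ioo 0 T := fun σ hσ => ⟨hs₁0.trans hσ.1, hσ.2.trans_lt hτT⟩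
  have hmiT : IntegrableOn m (Ioc (p 0) (p J)) := by
    rw [hp0, hpJ]
    exact ((hGi.mono_set hsub1).const_mul _).add (integrableOn_const measure_Ioc_lt_top.ne)
  have hchain := sub_le_integral_add_of_chain (fun j hj => (hmono j hj).le) hmiT hinc
  rw [hp0, hpJ] at hchain
  -- `∫_{(s₁,τ]} m ≤ C₀ (C_T + √d) M (1+T) + d c₂ C₀ T`
  have hIm : ∫ σ in Ioc s₁ τ, m σ ≤ C₀ * (CT + Real.sqrt n) * (M * (1 + T)) + c₂ * C₀ * T := by
    have hGI : ∫ σ in Ioc s₁ τ, G σ ≤ M * (1 + T) :=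
      (setIntegral_mono_set hGi (Eventually.of_forall hG0) (Eventually.of_forall hsub1)).trans hGint
    simp only [hm]
    rw [integral_add ((hGi.mono_set hsub1).const_mul _) (integrableOn_const measure_Ioc_lt_top.ne),
      integral_const_mul, setIntegral_const, Real.volume_real_Ioc_of_le hs₁τ.le, smul_eq_mul]
    have h1 : C₀ * (CT + Real.sqrt n) * ∫ σ in Ioc s₁ τ, G σ ≤ C₀ * (CT + Real.sqrt n) * (M * (1 + T)) :=
      mul_le_mul_of_nonneg_left hGI (by positivity)
    have h2 : (τ - s₁) * (c₂ * C₀) ≤ T * (c₂ * C₀) := mul_le_mul_of_nonneg_right (by linarith) (by positivity)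
    linarith
  -- the two small errors
  have hQ1 : δ⁻¹ * Real.sqrt Mv * T ≤ Q := by rw [hQ]; linarith
  have hQ2 : L₀ ≤ Q := by
    have h0 : 0 ≤ δ⁻¹ * Real.sqrt Mv * T := by positivity
    rw [hQ]; linarith
  have hcT : c * (τ - s₁) ≤ 1 / 2 := by
    calc c * (τ - s₁) ≤ c * T := mul_le_mul_of_nonneg_left (by linarith) (by positivity)
      _ = η * (δ⁻¹ * Real.sqrt Mv * T) := by rw [hc]; ring
      _ ≤ η * Q := mul_le_mul_of_nonneg_left hQ1 hη0.le
      _ = 1 / 2 := by rw [mul_comm, hηQ]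
  have hstart : krLogDist δ ρ₀ - Φ s₁ ≤ 1 / 2 := by
    have hε : ∀ x, |ρ₀ x - (θ s₁ ⋆ kernel δ) x| ≤ η := fun x => by
      have e := hdiff (Or.inl rfl) hs₁S hs₁0.le x
      simp only [if_true] at e
      rw [abs_sub_comm, e]
      exact hflux_small le_rfl hs₁0.le hs₁S.1.2 (by linarith) x
    have h1 := krLogDist_le_krLogDist_add_of_abs_sub_le hδ hρ₀i hρ₀0
      (hS_conv_c hs₁S).integrable_unitAddTorus (hS_conv0 hs₁S) hε
    have h2 : L₀ * η ≤ 1 / 2 := by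
      calc L₀ * η ≤ Q * η := mul_le_mul_of_nonneg_right hQ2 hη0.le
        _ = 1 / 2 := hηQ
    show krLogDist δ ρ₀ - krLogDist δ (θ s₁ ⋆ kernel δ) ≤ 1 / 2
    linarith
  have hE : C₀ * (CT + Real.sqrt n) * (M * (1 + T)) + c₂ * C₀ * T ≤ E₂ * (1 + T) := by
    have e : E₂ * (1 + T) = C₀ * (CT + Real.sqrt n) * (M * (1 + T)) + c₂ * C₀ * (1 + T) := by
      rw [hE₂, seisE2, ← hCT, ← hn, ← hc₂]; ring
    rw [e]
    have h0 : 0 ≤ c₂ * C₀ := by positivity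
    have h1 : c₂ * C₀ * T ≤ c₂ * C₀ * (1 + T) := mul_le_mul_of_nonneg_left (by linarith) h0
    linarith
  have hupper_chain : krLogDist δ ρ₀ - Φ τ ≤ E₂ * (1 + T) + 1 := by linarith [hstart, hchain, hIm, hcT, hE]
  -- lower endpoint: Lemma 4 at `ρ₀ = θ₀ ⋆ k_δ`
  have hgB : Real.sqrt (Fintype.card d) * (∫ z, ‖Torus.gradient θ₀ z‖) ≤ seisMod d B := by
    rw [seisMod]
    have h1 : Real.sqrt (Fintype.card d) * (∫ z, ‖Torus.gradient θ₀ z‖) ≤ Real.sqrt (Fintype.card d) * B :=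
      mul_le_mul_of_nonneg_left hB' (Real.sqrt_nonneg _)
    linarith
  have hmodθ₀ : ∀ y, eLpNorm (fun x => θ₀ (x - y) - θ₀ x) 1 volume ≤ ENNReal.ofReal (seisMod d B * ‖y‖) :=
    fun y => eLpNorm_translate_sub_le_integral_norm_gradient (hθ₀.isContDiff (by simp)) hgB y
  have hmodρ₀ : ∀ y, eLpNorm (fun x => ρ₀ (x - y) - ρ₀ x) 1 volume ≤ ENNReal.ofReal (seisMod d B * ‖y‖) :=
    fun y => (eLpNorm_sub_translate_convolution_kernel_le hθ₀i hδ hδ4 y).trans (hmodθ₀ y)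
  have hm₀ : a / 2 ≤ ∫ x, |ρ₀ x| := by
    have h1 : ∫ x, |ρ₀ x - θ₀ x| ≤ seisMod d B * δ :=
      integral_abs_convolution_kernel_sub_self_le hθ₀i hg.le hmodθ₀ hδ hδ4
    have hi2 : Integrable (fun x => |ρ₀ x - θ₀ x|) volume := (hρ₀i.sub hθ₀i).abs
    have h2 : ∫ x, |θ₀ x| ≤ (∫ x, |ρ₀ x|) + ∫ x, |ρ₀ x - θ₀ x| := by
      rw [← integral_add hρ₀i.abs hi2]
      refine integral_mono hθ₀i.abs (hρ₀i.abs.add hi2) fun x => ?_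
      have := abs_sub_abs_le_abs_sub (θ₀ x) (ρ₀ x)
      rw [abs_sub_comm] at this
      linarith
    have h3 : seisMod d B * δ ≤ a / 2 := by
      rw [le_div_iff₀ (by positivity)] at hδa
      linarith
    linarith
  have hlower : a / 16 * Real.log (1 + min (a / 2 / seisMod d B) 1 / (lemma4Const d * δ)) ≤ krLogDist δ ρ₀ := by
    have hL4 := krLogDist_ge_of_translation hδ hρ₀i hρ₀c.measurable hρ₀0 hg hmodρ₀
    set m₀ : ℝ := ∫ x, |ρ₀ x| with hm₀def
    -- monotonicity in `m₀ ≥ a/2`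
    have hx : min (a / 2 / seisMod d B) 1 ≤ min (m₀ / seisMod d B) 1 :=
      min_le_min (div_le_div_of_nonneg_right hm₀ hg.le) le_rfl
    have hx0 : 0 ≤ min (a / 2 / seisMod d B) 1 := le_min (by positivity) zero_le_one
    have hlog0 : 0 ≤ Real.log (1 + min (a / 2 / seisMod d B) 1 / (lemma4Const d * δ)) :=
      Real.log_nonneg (by
        have : 0 ≤ min (a / 2 / seisMod d B) 1 / (lemma4Const d * δ) :=
          div_nonneg hx0 (mul_nonneg (lemma4Const_nonneg d) hδ.le)
        linarith)
    have hlogmono : Real.log (1 + min (a / 2 / seisMod d B) 1 / (lemma4Const d * δ)) ≤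
        Real.log (1 + min (m₀ / seisMod d B) 1 / (lemma4Const d * δ)) := by
      refine Real.log_le_log (by
        have : 0 ≤ min (a / 2 / seisMod d B) 1 / (lemma4Const d * δ) :=
          div_nonneg hx0 (mul_nonneg (lemma4Const_nonneg d) hδ.le)
        linarith) ?_
      linarith [div_le_div_of_nonneg_right hx (mul_nonneg (lemma4Const_nonneg d) hδ.le)]
    calc a / 16 * Real.log (1 + min (a / 2 / seisMod d B) 1 / (lemma4Const d * δ))
        ≤ m₀ / 8 * Real.log (1 + min (m₀ / seisMod d B) 1 / (lemma4Const d * δ)) :=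
          mul_le_mul (by linarith) hlogmono hlog0 (by linarith)
      _ ≤ krLogDist δ ρ₀ := hL4
  -- upper endpoint: brutal estimate at `τ`
  have hupper : Φ τ ≤ L₀ * (C₀ * Real.exp (-(N : ℝ))) := by
    have h1 : Φ τ ≤ L₀ * ∫ x, |(θ τ ⋆ kernel δ) x| :=
      krLogDist_le hδ (hS_conv_c hτS).integrable_unitAddTorus (hS_conv0 hτS)
    have h2 : ∫ x, |(θ τ ⋆ kernel δ) x| ≤ C₀ * Real.exp (-(D * τ)) := by
      refine (integral_abs_convolution_kernel_le hτS.2.2.2.2.1 hδ hδ4).trans ?_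
      refine (integral_abs_le_sqrt_integral_sq hτS.2.2.2.1).trans ?_
      rw [← Real.sqrt_sq (by positivity : 0 ≤ C₀ * Real.exp (-(D * τ)))]
      exact Real.sqrt_le_sqrt hτS.2.2.2.2.2.2.2.1
    have h3 : Real.exp (-(D * τ)) ≤ Real.exp (-(N : ℝ)) := by
      refine Real.exp_le_exp.2 (neg_le_neg ?_)
      have := hτI.1.le
      rw [div_le_iff₀ hD] at this
      linarith
    have h4 : C₀ * Real.exp (-(D * τ)) ≤ C₀ * Real.exp (-(N : ℝ)) := mul_le_mul_of_nonneg_left h3 hC₀.le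
    calc Φ τ ≤ L₀ * ∫ x, |(θ τ ⋆ kernel δ) x| := h1
      _ ≤ L₀ * (C₀ * Real.exp (-(N : ℝ))) := mul_le_mul_of_nonneg_left (h2.trans h4) hL₀0
  linarith

/-! # Part C — windowed Remark 1, the windowed strain class, the sharpened floor (filed: `Negative/SeisWindow.lean`) -/

/-! ## Seis 2022, Remark 1 — windowed form -/

/-- The number of e-foldings Seis' argument waits for: `N = ⌈log(32 C₀ / a)⌉` (depends on the datum's
`L¹` mass `a` and the decay prefactor `C₀` only — not on `κ`, the rate or the drift). -/
def seisN (a C₀ : ℝ) : ℕ := ⌈Real.log (32 * C₀ / a)⌉₊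

/-- The dissipation horizon `T = (N+1)/D + 2` of Seis' argument at rate `D`. -/
def seisHorizon (a C₀ D : ℝ) : ℝ := ((seisN a C₀ : ℝ) + 1) / D + 2

/-- The horizon is positive for `D > 0`. [folklore] -/
theorem seisHorizon_pos {a C₀ D : ℝ} (hD : 0 < D) : 0 < seisHorizon a C₀ D := by
  unfold seisHorizon; positivity

/-- **Seis 2022, Remark 1 (`p = q = r = 2`), windowed form.** For every dimension and constants
`a > 0`, `B`, `C₀ > 0`, `M ≥ 0` there are `κ₀ ∈ (0,1)` and `K ≥ 0` such that for all `κ ∈ (0, κ₀]`,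
every rate `0 < D ≤ 1` and the horizon `T = seisHorizon a C₀ D = (N+1)/D + 2`, `N = seisN a C₀`: every
drift `u` essentially bounded in energy on `(0,T)` with `∫⁻_{(0,T)} ‖∇u‖₂ ≤ M(1+T)`, every smooth
mean-zero datum with `a ≤ ‖θ₀‖₁`, `‖∇θ₀‖₁ ≤ B`, and every weak solution `θ` on `[0,T)` with
`‖θ(t)‖²₂ ≤ (C₀ e^{-Dt})²` for a.e. `t ∈ (0,T)` satisfy `D ≤ K / log(1/κ)`. The horizon does not depend
on `M` (only `K` does), which is what lets windowed strain bounds with window-dependent constants be fed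
in. (The tree's discharge of `Seis2022_rmk1_L2`, run on the window.) [cite: Seis2022, Remark 1 (p. 4); Thm 2, proof §2.2 (pp. 7–8)] -/
theorem seis_rmk1_window (a B C₀ M : ℝ) (ha : 0 < a) (hC₀ : 0 < C₀) (hM : 0 ≤ M) :
    ∃ κ₀ K : ℝ, 0 < κ₀ ∧ κ₀ < 1 ∧ 0 ≤ K ∧
      ∀ (κ D : ℝ) (u : ℝ → UnitAddTorus d → EuclideanSpace ℝ d) (θ₀ : UnitAddTorus d → ℝ)
        (θ : ℝ → UnitAddTorus d → ℝ),
        0 < κ → κ ≤ κ₀ → 0 < D → D ≤ 1 →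
        (∃ Mv : ℝ≥0, ∀ᵐ t ∂((volume : Measure ℝ).restrict (Ioo 0 (seisHorizon a C₀ D))),
          ∫⁻ x, ‖u t x‖ₑ ^ 2 ≤ Mv) →
        (∫⁻ τ in Ioo 0 (seisHorizon a C₀ D), eGradNormSq (u τ) ^ (1 / 2 : ℝ) ≤
          ENNReal.ofReal (M * (1 + seisHorizon a C₀ D))) →
        IsSmooth θ₀ → HasZeroMean θ₀ → a ≤ ∫ x, |θ₀ x| → ∫ x, ‖Torus.gradient θ₀ x‖ ≤ B →
        Torus.IsWeakScalarTransportOn (seisHorizon a C₀ D) κ u θ₀ θ →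
        (∀ᵐ t ∂((volume : Measure ℝ).restrict (Ioo 0 (seisHorizon a C₀ D))),
            Torus.scalarL2Sq (θ t) ≤ (C₀ * Real.exp (-(D * t))) ^ 2) →
        D ≤ K / Real.log κ⁻¹ := by
  classical
  -- constants (as in the tree's discharge of `Seis2022_rmk1_L2`)
  set g : ℝ := seisMod d (max B 0) with hg
  have hg0 : 0 < g := seisMod_pos d (le_max_right _ _)
  set x₀ : ℝ := min (a / 2 / g) 1 with hx₀
  have hx₀0 : 0 < x₀ := lt_min (by positivity) one_pos
  set C₄ : ℝ := lemma4Const d with hC₄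
  set N : ℕ := seisN a C₀ with hN
  set E₂ : ℝ := seisE2 d C₀ M with hE₂
  have hE₂0 : 0 ≤ E₂ := seisE2_nonneg d hC₀.le hM
  set E₁ : ℝ := a / 16 * |Real.log (x₀ / C₄)| with hE₁
  have hE₁0 : 0 ≤ E₁ := by positivity
  set K : ℝ := 128 * (E₂ * ((N : ℝ) + 4) + 1) / a with hK
  have hK0 : 0 ≤ K := by positivity
  set κ₀ : ℝ := min (min (1 / 16) ((a / (2 * g)) ^ 2))
    (min (Real.exp (-(128 * E₁ / a))) (Real.exp (-(K + 1)))) with hκ₀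
  have hκ₀0 : 0 < κ₀ :=
    lt_min (lt_min (by norm_num) (by positivity)) (lt_min (Real.exp_pos _) (Real.exp_pos _))
  have hκ₀1 : κ₀ < 1 := (min_le_left _ _).trans_lt ((min_le_left _ _).trans_lt (by norm_num))
  refine ⟨κ₀, K, hκ₀0, hκ₀1, hK0, ?_⟩
  intro κ D u θ₀ θ hκ hκκ₀ hD0 hD1 hu2 hgrad hθ₀ hmean ha' hB' hsol hdecay
  simp only [seisHorizon] at hu2 hgrad hsol hdecay
  rw [← hN] at hu2 hgrad hsol hdecay
  -- facts about `κ`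
  have hκ16 : κ ≤ 1 / 16 := hκκ₀.trans ((min_le_left _ _).trans (min_le_left _ _))
  have hκa : κ ≤ (a / (2 * g)) ^ 2 := hκκ₀.trans ((min_le_left _ _).trans (min_le_right _ _))
  have hκE₁ : κ ≤ Real.exp (-(128 * E₁ / a)) := hκκ₀.trans ((min_le_right _ _).trans (min_le_left _ _))
  have hκK : κ ≤ Real.exp (-(K + 1)) := hκκ₀.trans ((min_le_right _ _).trans (min_le_right _ _))
  have hlogκ : 0 < Real.log κ⁻¹ := Real.log_pos (by rw [lt_inv_comm₀ one_pos hκ, inv_one]; linarith)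
  have hlog_ge : ∀ {y : ℝ}, κ ≤ Real.exp (-y) → y ≤ Real.log κ⁻¹ := fun {y} hy => by
    rw [Real.log_inv, le_neg, ← Real.log_exp (-y)]
    exact Real.log_le_log hκ hy
  -- degenerate dimension
  rcases isEmpty_or_nonempty d with hd | hd
  · exfalso
    have := integral_abs_eq_zero_of_isEmpty (d := d) hmean
    linarith
  have hC₄0 : 0 < C₄ := lemma4Const_pos
  -- `δ = √κ`
  set δ : ℝ := Real.sqrt κ with hδdef
  have hδ : 0 < δ := Real.sqrt_pos.2 hκ
  have hκδ : κ = δ ^ 2 := (Real.sq_sqrt hκ.le).symm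
  have hδ4 : δ ≤ 1 / 4 := by
    rw [hδdef, show (1 / 4 : ℝ) = Real.sqrt (1 / 16) by
      rw [show (1 / 16 : ℝ) = (1 / 4) ^ 2 by norm_num, Real.sqrt_sq (by norm_num)]]
    exact Real.sqrt_le_sqrt hκ16
  have hδa : δ ≤ a / (2 * g) := by
    rw [hδdef, ← Real.sqrt_sq (by positivity : 0 ≤ a / (2 * g))]
    exact Real.sqrt_le_sqrt hκa
  have hlogδ : Real.log δ⁻¹ = Real.log κ⁻¹ / 2 := by
    rw [Real.log_inv, Real.log_inv, hδdef, Real.log_sqrt hκ.le]; ring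
  -- `N`
  have hN' : C₀ * Real.exp (-(N : ℝ)) ≤ a / 32 := by
    have h1 : Real.log (32 * C₀ / a) ≤ N := by rw [hN]; exact Nat.le_ceil _
    have h2 : 32 * C₀ / a ≤ Real.exp (N : ℝ) := by
      rw [← Real.exp_log (by positivity : 0 < 32 * C₀ / a)]
      exact Real.exp_le_exp.2 h1
    have hpos := Real.exp_pos (N : ℝ)
    rw [div_le_iff₀ ha] at h2
    rw [Real.exp_neg, le_div_iff₀ (by norm_num : (0 : ℝ) < 32),
      show C₀ * (Real.exp (N : ℝ))⁻¹ * 32 = (32 * C₀) / Real.exp (N : ℝ) by ring, div_le_iff₀ hpos]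
    linarith [h2, mul_comm (Real.exp (N : ℝ)) a]
  -- data facts
  obtain ⟨M', hM'⟩ := hu2
  have hu2' : ∀ᵐ t ∂((volume : Measure ℝ).restrict (Ioo 0 (((N : ℝ) + 1) / D + 2))),
      ∫⁻ x, ‖u t x‖ₑ ^ 2 ≤ ENNReal.ofReal (M' : ℝ) := by
    simpa only [ENNReal.ofReal_coe_nnreal] using hM'
  have hB'' : ∫ x, ‖Torus.gradient θ₀ x‖ ≤ max B 0 := hB'.trans (le_max_left _ _)
  -- the core at rate `D ≤ 1` on the window, and the endgame
  have hcore := seis_core_window (d := d) ha (le_max_right B 0) hC₀ hM (NNReal.coe_nonneg M') hD0 hδ hκδ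
    hδ4 hδa N hu2' hgrad hθ₀ hmean ha' hB'' hsol hdecay
  have hmain : a / 32 * Real.log δ⁻¹ - E₁ ≤ (E₂ * ((N : ℝ) + 4) + 1) / D :=
    endgame_algebra ha hC₀ hC₄0 hx₀0 hE₂0 hD0 hD1 hδ hδ4 hN' hcore
  have hℓE₁ : 128 * E₁ / a ≤ Real.log κ⁻¹ := hlog_ge hκE₁
  have hkey : D * Real.log κ⁻¹ ≤ K := by
    rw [hlogδ] at hmain
    have h1 : E₁ ≤ a / 128 * Real.log κ⁻¹ := by
      rw [div_le_iff₀ ha] at hℓE₁; linarith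
    have h2 : a / 128 * Real.log κ⁻¹ ≤ (E₂ * ((N : ℝ) + 4) + 1) / D := by linarith
    rw [le_div_iff₀ hD0] at h2
    rw [hK, le_div_iff₀ ha]
    nlinarith
  rw [le_div_iff₀ hlogκ]
  exact hkey


/-! ## The windowed strain class and the sharpened Seis floor for `RelaxingFamily` -/

section Planar



/-- **Windowed strain budget**: one slope `M ≥ 0` such that for every level `j` and every window
length `L > 0` some phase `s ≥ 0` has `∫₀ᴸ ‖∇v_j(s + τ)‖_{L²} dτ ≤ M (1 + L)`
(`‖∇w‖_{L²} = (eGradNormSq w)^{1/2}`). -/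
def WindowedStrainBudget (_g : 𝕋² → E²) (_h : 𝕋² → ℝ) (_ν : ℕ → ℝ) (v : ℕ → ℝ → 𝕋² → E²) : Prop :=
  ∃ M : ℝ, 0 ≤ M ∧ ∀ (j : ℕ) (L : ℝ), 0 < L → ∃ s : ℝ, 0 ≤ s ∧
    ∫⁻ τ in Ioo 0 L, eGradNormSq (v j (s + τ)) ^ (1 / 2 : ℝ) ≤ ENNReal.ofReal (M * (1 + L))

/-- **Tame phases**: for every window length `L > 0` there is a bound `R` (depending on `L` in any way)
such that every level `j` has SOME phase `s ≥ 0` with windowed strain `∫₀ᴸ ‖∇v_j(s + τ)‖_{L²} dτ ≤ R`.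
Its negation: for some window length `L*`, `sup_j inf_{s ≥ 0} ∫ₛ^{s+L*} ‖∇v_j‖₂ = ∞` — at suitable levels
EVERY window of length `L*` is wild. -/
def TamePhases (_g : 𝕋² → E²) (_h : 𝕋² → ℝ) (_ν : ℕ → ℝ) (v : ℕ → ℝ → 𝕋² → E²) : Prop :=
  ∀ L : ℝ, 0 < L → ∃ R : ℝ, ∀ j : ℕ, ∃ s : ℝ, 0 ≤ s ∧
    ∫⁻ τ in Ioo 0 L, eGradNormSq (v j (s + τ)) ^ (1 / 2 : ℝ) ≤ ENNReal.ofReal R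

/-- **Initially tame strain**: for every window length `L > 0` the strain on the INITIAL window
`∫₀ᴸ ‖∇v_j(τ)‖_{L²} dτ` is bounded uniformly in `j` (cold / laminar / `j`-uniformly smooth starts). -/
def InitiallyTame (_g : 𝕋² → E²) (_h : 𝕋² → ℝ) (_ν : ℕ → ℝ) (v : ℕ → ℝ → 𝕋² → E²) : Prop :=
  ∀ L : ℝ, 0 < L → ∃ R : ℝ, ∀ j : ℕ,
    ∫⁻ τ in Ioo 0 L, eGradNormSq (v j τ) ^ (1 / 2 : ℝ) ≤ ENNReal.ofReal R

/-- A windowed strain budget gives tame phases. [folklore] -/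
theorem tamePhases_of_windowedStrainBudget {g : 𝕋² → E²} {h : 𝕋² → ℝ} {ν : ℕ → ℝ}
    {v : ℕ → ℝ → 𝕋² → E²} (hB : WindowedStrainBudget g h ν v) : TamePhases g h ν v := by
  obtain ⟨M, -, hb⟩ := hB
  exact fun L hL => ⟨M * (1 + L), fun j => hb j L hL⟩

/-- A linear windowed enstrophy budget from some phase on is a windowed strain budget (same slope,
same phase for every window). [folklore] -/
theorem windowedStrainBudget_of_linearEnstrophyBudget {g : 𝕋² → E²} {h : 𝕋² → ℝ} {ν : ℕ → ℝ}
    {v : ℕ → ℝ → 𝕋² → E²} (hB : LinearEnstrophyBudget g h ν v) : WindowedStrainBudget g h ν v := by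
  obtain ⟨M, hM, hb⟩ := hB
  refine ⟨M, hM, fun j L hL => ?_⟩
  obtain ⟨s, hs, -, hbud⟩ := hb j
  exact ⟨s, hs, hbud L hL⟩

/-- Initially tame strain gives tame phases (phase `0`). [folklore] -/
theorem tamePhases_of_initiallyTame {g : 𝕋² → E²} {h : 𝕋² → ℝ} {ν : ℕ → ℝ}
    {v : ℕ → ℝ → 𝕋² → E²} (hI : InitiallyTame g h ν v) : TamePhases g h ν v := by
  intro L hL
  obtain ⟨R, hR⟩ := hI L hL
  refine ⟨R, fun j => ⟨0, le_rfl, ?_⟩⟩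
  simpa only [zero_add] using hR j

/-- **Finite-window energy bounds are automatic for Leray–Hopf drifts**: for `s ≥ 0`, `T > 0` the
shifted drift `u(s + ·)` is essentially bounded in energy on `(0,T)` (the interface field
`energy_bound` on `(0, s + T)`, transported along `t ↦ s + t`). [folklore] -/
theorem exists_energy_bound_shift {ν : ℝ} {f : ℝ → 𝕋² → E²} {u₀ : 𝕋² → E²} {u : ℝ → 𝕋² → E²}
    (hu : IsGlobalLerayHopf ν f u₀ u) {s T : ℝ} (hs : 0 ≤ s) (hT : 0 < T) :
    ∃ M : ℝ≥0, ∀ᵐ t ∂((volume : Measure ℝ).restrict (Ioo 0 T)), ∫⁻ x, ‖u (s + t) x‖ₑ ^ 2 ≤ M := by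
  obtain ⟨M, hM⟩ := (hu (s + T) (by linarith)).energy_bound
  refine ⟨M, ae_restrict_Ioo_add_left s (P := fun t => ∫⁻ x, ‖u t x‖ₑ ^ 2 ≤ M) ?_⟩
  rw [add_zero]
  exact ae_restrict_of_ae_restrict_of_subset (Ioo_subset_Ioo hs le_rfl) hM

/-- **`RelaxingFamily` is false with tame phases** (Seis' floor on the dissipation horizon,
unconditional): a witness of crux r3 has a window length `L*` such that for every `R` some level `j` has
windowed strain `∫ₛ^{s+L*} ‖∇v_j‖₂ > R` from EVERY phase `s ≥ 0`. Proof: rate `D = min(γ/2, 1)`, horizon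
`T = seisHorizon(‖h‖₁, C₀, D)` from the profile data ALONE, the class' bound `R` for the window `T`, Seis'
windowed constants `(κ₀, K)` for slope `M = max R 0`, the level `j` with `ν_j ≤ κ₀` and
`log(1/ν_j) > K/D + 1`, the class' phase `s` at level `j`; the release of `h` into `v_j(s + ·)` on
`[0,T)` exists (`IsGlobalLerayHopf.exists_release`), the drift is bounded in energy on the window
(`exists_energy_bound_shift`), the crux's clause gives the decay on `(0,T)`, and `seis_rmk1_window` gives
`D ≤ K/log(1/ν_j)`, contradiction. [cite: Seis2022, Thm 2 and Remark 1 (arXiv:2003.08794 pp. 3–4)] -/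
theorem relaxingFamily_false_with_tamePhases : ¬ RelaxingFamilyUnder TamePhases := by
  rintro ⟨g, h, -, -, -, hh, hhm, hh0, ν, v₀, v, hν, hνlim, hLH, -, -, htame, C, γ, hC, hγ, hrelax⟩
  -- profile constants
  have ha : 0 < ∫ x, |h x| := integral_abs_pos_of_ne_zero hh hh0
  have hS : 0 < scalarL2Sq h := scalarL2Sq_pos_of_ne_zero hh hh0
  set C₀ : ℝ := Real.sqrt ((C + 1) * scalarL2Sq h) with hC₀def
  have hC₀sq : C₀ ^ 2 = (C + 1) * scalarL2Sq h := Real.sq_sqrt (by positivity)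
  have hC₀ : 0 < C₀ := Real.sqrt_pos.2 (by positivity)
  -- the rate and the horizon (profile data only)
  set D : ℝ := min (γ / 2) 1 with hD
  have hD0 : 0 < D := lt_min (by positivity) one_pos
  have hD1 : D ≤ 1 := min_le_right _ _
  have hDγ : D ≤ γ / 2 := min_le_left _ _
  set T : ℝ := seisHorizon (∫ x, |h x|) C₀ D with hT
  have hT0 : 0 < T := seisHorizon_pos hD0
  -- the class' bound for this window, and Seis' constants for that slope
  obtain ⟨R, hR⟩ := htame T hT0
  set M : ℝ := max R 0 with hMdef
  have hM : 0 ≤ M := le_max_right _ _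
  obtain ⟨κ₀, K, hκ₀, -, hK, hSeis⟩ :=
    seis_rmk1_window (d := Fin 2) (∫ x, |h x|) (∫ x, ‖Torus.gradient h x‖) C₀ M ha hC₀ hM
  -- the level `j`: `ν_j ≤ κ₀` and `log (1/ν_j) > K/D + 1`
  set L₀ : ℝ := K / D + 1 with hL₀
  have hL₀pos : 0 < L₀ := by
    have : 0 ≤ K / D := by positivity
    linarith
  obtain ⟨j, hj⟩ : ∃ j, ν j < min κ₀ (Real.exp (-L₀)) :=
    (hνlim.eventually (gt_mem_nhds (lt_min hκ₀ (Real.exp_pos _)))).exists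
  have hνκ : ν j ≤ κ₀ := (hj.trans_le (min_le_left _ _)).le
  have hlog : L₀ < Real.log (ν j)⁻¹ := by
    rw [Real.log_inv]
    have h1 : Real.log (ν j) < Real.log (Real.exp (-L₀)) :=
      Real.log_lt_log (hν j) (hj.trans_le (min_le_right _ _))
    rw [Real.log_exp] at h1
    linarith
  -- the phase at level `j` and its budget
  obtain ⟨s, hs, hbudR⟩ := hR j
  have hbud : ∫⁻ τ in Ioo 0 T, eGradNormSq (v j (s + τ)) ^ (1 / 2 : ℝ) ≤
      ENNReal.ofReal (M * (1 + T)) := by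
    refine hbudR.trans (ENNReal.ofReal_le_ofReal ?_)
    have h1 : R ≤ M := le_max_left _ _
    nlinarith [hT0.le, hM]
  -- energy on the window, a release on `[0,T)`, its decay on `(0,T)`
  obtain ⟨Mv, hMv⟩ := exists_energy_bound_shift (hLH j) hs hT0
  obtain ⟨θ, hθ, -⟩ := (hLH j).exists_release (hν j) hT0 hs (hh.memLp 2)
  have hdec : ∀ᵐ t ∂((volume : Measure ℝ).restrict (Ioo 0 T)),
      scalarL2Sq (θ t) ≤ (C₀ * Real.exp (-(D * t))) ^ 2 := by
    filter_upwards [hrelax j s hs T θ hθ, ae_restrict_mem measurableSet_Ioo] with t ht ht0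
    have hexp : Real.exp (-(γ * t)) ≤ Real.exp (-(2 * D * t)) :=
      Real.exp_le_exp.2 (by nlinarith [ht0.1])
    have e1 : (C₀ * Real.exp (-(D * t))) ^ 2 = (C + 1) * scalarL2Sq h * Real.exp (-(2 * D * t)) := by
      rw [mul_pow, hC₀sq, sq (Real.exp _), ← Real.exp_add]
      congr 1
      ring
    rw [e1]
    have hE : 0 ≤ Real.exp (-(2 * D * t)) := (Real.exp_pos _).le
    calc scalarL2Sq (θ t) ≤ C * Real.exp (-(γ * t)) * scalarL2Sq h := ht
      _ ≤ C * Real.exp (-(2 * D * t)) * scalarL2Sq h := by gcongr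
      _ ≤ (C + 1) * scalarL2Sq h * Real.exp (-(2 * D * t)) := by nlinarith [hS.le]
  -- Seis on the window at rate `D`
  have hDle : D ≤ K / Real.log (ν j)⁻¹ :=
    hSeis (ν j) D (fun t => v j (s + t)) h θ (hν j) hνκ hD0 hD1 ⟨Mv, hMv⟩ hbud hh hhm le_rfl le_rfl
      hθ hdec
  -- contradiction with the choice of `j`
  have hLpos : 0 < Real.log (ν j)⁻¹ := hL₀pos.trans hlog
  rw [le_div_iff₀ hLpos] at hDle
  have h1 : D * L₀ < D * Real.log (ν j)⁻¹ := mul_lt_mul_of_pos_left hlog hD0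
  have h2 : D * L₀ = K + D := by rw [hL₀]; field_simp
  linarith

/-- **`RelaxingFamily` is false without super-linear WINDOWED strain** (corollary): no witness of crux
r3 admits one slope `M` such that every level and every window length have a phase with
`∫₀ᴸ‖∇v_j(s+τ)‖₂ dτ ≤ M(1+L)` — sharpening of the landed `relaxingFamily_false_without_superlinearEnstrophy`
(no uniform-in-time energy hypothesis, no budget at all times). [cite: Seis2022, Remark 1 (arXiv:2003.08794 p. 4)] -/
theorem relaxingFamily_false_without_superlinearWindowedStrain :
    ¬ RelaxingFamilyUnder WindowedStrainBudget := fun hR =>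
  relaxingFamily_false_with_tamePhases (hR.mono fun _ _ _ _ => tamePhases_of_windowedStrainBudget)

/-- **`RelaxingFamily` is false with initially tame strain** (corollary; "the data must be pre-stirred"):
since (U_h) is demanded from phase `0`, no witness of crux r3 has `j`-uniformly bounded strain
`∫₀ᴸ‖∇v_j‖₂` on every initial window — cold, laminar or `j`-uniformly smooth starts are dead; at some
level the FIRST window of some fixed length already carries arbitrarily large strain. [cite: Seis2022, Remark 1 (arXiv:2003.08794 p. 4)] -/
theorem relaxingFamily_false_with_initiallyTame :
    ¬ RelaxingFamilyUnder InitiallyTame := fun hR =>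
  relaxingFamily_false_with_tamePhases (hR.mono fun _ _ _ _ => tamePhases_of_initiallyTame)

end Planar

/-! # Part D — good phases and the single-shell kill (filed: `Negative/SingleShell.lean`) -/

/-! ## Good phases -/

/-- **Record lemma.** If `G` is continuous on every `[A, R]` and `G → -∞` at `+∞`, some `s ≥ A`
dominates its future: `G t ≤ G s` for all `t ≥ s` (maximise `G` on `[A, R]` with `R` so large that
`G < G A - 1` beyond it). [folklore] -/
theorem exists_dominating_point {G : ℝ → ℝ} {A : ℝ} (hG : ∀ R, ContinuousOn G (Icc A R))
    (hlim : Tendsto G atTop atBot) : ∃ s, A ≤ s ∧ ∀ t, s ≤ t → G t ≤ G s := by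
  obtain ⟨R, hR⟩ := eventually_atTop.1 (hlim.eventually (eventually_le_atBot (G A - 1)))
  set R' := max R A with hR'
  obtain ⟨s, hs, hmax⟩ := (isCompact_Icc : IsCompact (Icc A R')).exists_isMaxOn
    (nonempty_Icc.2 (le_max_right _ _)) (hG R')
  refine ⟨s, hs.1, fun t hst => ?_⟩
  by_cases htR : t ≤ R'
  · exact hmax ⟨hs.1.trans hst, htR⟩
  · have h1 : G t ≤ G A - 1 := hR t ((le_max_left _ _).trans (not_le.1 htR).le)
    have h2 : G A ≤ G s := hmax ⟨le_rfl, le_max_right _ _⟩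
    linarith

/-- **Good phases from the mean energy.** Along a global Leray–Hopf solution on `𝕋²` with steady
smooth mean-zero force, `ν > 0` and `meanEnergy u ≤ E`: for every `A ≥ 0` there is `s ≥ A` with
`∫ₛ^{s+t} ‖u(τ)‖₂² dτ ≤ 2 (max E 0 + 1) t` for every `t ≥ 0`. The Cesàro means of the energy are
bounded at fixed `ν` (Doering–Foias), so `limsup ≤ E` gives `∫₀ᵀ‖u‖² ≤ (E⁺+1)T` eventually and
`x ↦ ∫₀ˣ‖u‖² - 2(E⁺+1)x → -∞`; a dominating point of that function is a good phase. [cite: DoeringFoias2002, §2] -/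
theorem exists_goodPhase_energy {ν : ℝ} {g u₀ : 𝕋² → E²} {u : ℝ → 𝕋² → E²} (hν : 0 < ν)
    (hg : IsSmooth g) (hgm : HasZeroMean g) (hu : IsGlobalLerayHopf ν (fun _ => g) u₀ u) {E : ℝ}
    (hE : meanEnergy u ≤ E) {A : ℝ} (hA : 0 ≤ A) :
    ∃ s, A ≤ s ∧ ∀ t, 0 ≤ t → ∫ τ in s..(s + t), (∫ x, ‖u τ x‖ ^ 2) ≤ 2 * (max E 0 + 1) * t := by
  set Ef : ℝ → ℝ := fun t => ∫ x, ‖u t x‖ ^ 2 with hEf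
  set c : ℝ := max E 0 + 1 with hc
  have hc0 : 0 < c := by have := le_max_right E 0; rw [hc]; linarith
  -- integrability on `[0, R]`, `R ≥ 0`
  have hint : ∀ {R : ℝ}, 0 ≤ R → IntervalIntegrable Ef volume 0 R := fun {R} hR => by
    rcases hR.eq_or_lt with rfl | hR'
    · exact IntervalIntegrable.refl
    · exact (intervalIntegrable_iff_integrableOn_Ioc_of_le hR).2 (hu.integrableOn_integral_norm_sq hR')
  -- the record function
  set G : ℝ → ℝ := fun x => (∫ τ in (0 : ℝ)..x, Ef τ) - 2 * c * x with hG
  have hGc : ∀ R, ContinuousOn G (Icc A R) := by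
    intro R
    rcases lt_or_ge R A with hRA | hRA
    · rw [Icc_eq_empty_of_lt hRA]; exact continuousOn_empty _
    have hR0 : 0 ≤ R := hA.trans hRA
    have hprim : ContinuousOn (fun x => ∫ τ in (0 : ℝ)..x, Ef τ) (Icc 0 R) := by
      have h1 : IntegrableOn Ef (uIcc 0 R) volume := by
        rw [uIcc_of_le hR0, integrableOn_Icc_iff_integrableOn_Ioc]
        rcases hR0.eq_or_lt with h | h
        · rw [← h, Ioc_self]; exact integrableOn_empty
        · exact hu.integrableOn_integral_norm_sq h
      have := intervalIntegral.continuousOn_primitive_interval h1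
      rwa [uIcc_of_le hR0] at this
    exact (hprim.mono (Icc_subset_Icc hA le_rfl)).sub ((continuous_const.mul continuous_id).continuousOn)
  -- `G → -∞`: honest Cesàro means (Doering–Foias) and `limsup ≤ E`
  have hbdd : IsBoundedUnder (· ≤ ·) atTop (timeMean Ef) :=
    isBoundedUnder_of_eventually_le
      (eventually_atTop.2 ⟨1, fun T hT => hu.timeMean_norm_sq_le hν hg hgm hT⟩)
  have hlimsup : limsup (timeMean Ef) atTop ≤ E := by
    have h1 := meanEnergy_eq_longTimeAvgSup u
    unfold longTimeAvgSup at h1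
    rw [← h1]; exact hE
  have hev : ∀ᶠ T in atTop, timeMean Ef T < c :=
    eventually_lt_of_limsup_lt (hlimsup.trans_lt (by have := le_max_left E 0; rw [hc]; linarith)) hbdd
  have hGle : ∀ᶠ T in atTop, G T ≤ -(c * T) := by
    filter_upwards [hev, eventually_gt_atTop (0 : ℝ)] with T hT hT0
    have h1 : ∫ τ in (0 : ℝ)..T, Ef τ = T * timeMean Ef T := by
      unfold timeMean; field_simp
    have h2 : ∫ τ in (0 : ℝ)..T, Ef τ ≤ T * c := by
      rw [h1]; exact mul_le_mul_of_nonneg_left hT.le hT0.le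
    simp only [hG]
    nlinarith
  have hlim : Tendsto G atTop atBot :=
    tendsto_atBot_mono' atTop hGle (tendsto_neg_atTop_atBot.comp (tendsto_id.const_mul_atTop hc0))
  -- a dominating point is a good phase
  obtain ⟨s, hAs, hdom⟩ := exists_dominating_point hGc hlim
  refine ⟨s, hAs, fun t ht => ?_⟩
  have hs0 : 0 ≤ s := hA.trans hAs
  have h1 := hdom (s + t) (by linarith)
  simp only [hG] at h1
  have hsplit : (∫ τ in (0 : ℝ)..(s + t), Ef τ) - ∫ τ in (0 : ℝ)..s, Ef τ = ∫ τ in s..(s + t), Ef τ :=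
    intervalIntegral.integral_interval_sub_left (hint (by linarith)) (hint hs0)
  rw [← hsplit]
  rw [hc] at h1 ⊢
  linarith

/-! ## Single-shell forcing gives a windowed strain budget -/

/-- The steady force lives on ONE Fourier shell `|k|² = m`, `m > 0`. -/
def IsSingleShell (g : 𝕋² → E²) : Prop :=
  ∃ m : ℝ, 0 < m ∧ ∀ k : Fin 2 → ℤ, freqNormSq k ≠ m →
    UnitAddTorus.mFourierCoeff (EuclideanSpace.complexify ∘ g) k = 0

/-- **Single-shell forcing ⇒ windowed strain budget (uniform slope).** Along a family of global
planar Leray–Hopf solutions driven by a smooth mean-zero single-shell force at level `m` with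
`meanEnergy (v j) ≤ E`, every level and every window length admit a phase `s ≥ 0` with
`∫₀ᴸ ‖∇v_j(s+τ)‖₂ dτ ≤ √(4π²m·2(E⁺+1) + 1) (1 + L)`. Per level: restart at a good Leray–Hopf time
`s₀` (`exists_isGlobalLerayHopf_translate`), pincer `‖∇v(t)‖² ≤ 4π²m‖v(t)‖² + K e^{-c(t-s₀-1)}`
(`shellPincer_of_singleShell`, `c = 8π²mν`), wait `K/c` so that the transient is `≤ 1`, take a good
phase of `exists_goodPhase_energy` beyond, and Cauchy–Schwarz on the window. [cite: ConstantinTarfuleaVicol2013, §2 (enst)] -/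
theorem windowedStrainBudget_of_singleShell {g : 𝕋² → E²} {h : 𝕋² → ℝ} {ν : ℕ → ℝ}
    {v₀ : ℕ → 𝕋² → E²} {v : ℕ → ℝ → 𝕋² → E²} (hg : IsSmooth g) (hgm : HasZeroMean g)
    (hg1 : IsSingleShell g) (hν : ∀ j, 0 < ν j)
    (hLH : ∀ j, IsGlobalLerayHopf (ν j) (fun _ => g) (v₀ j) (v j)) {E : ℝ}
    (hE : ∀ j, meanEnergy (v j) ≤ E) : WindowedStrainBudget g h ν v := by
  obtain ⟨m, hm, hshell⟩ := hg1
  set Λ : ℝ := 4 * Real.pi ^ 2 * m with hΛ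
  have hΛ0 : 0 ≤ Λ := by positivity
  set B : ℝ := 2 * (max E 0 + 1) with hB
  have hB0 : 0 ≤ B := by have := le_max_right E 0; rw [hB]; nlinarith
  set Z : ℝ := Λ * B + 1 with hZ
  have hZ0 : 0 ≤ Z := by positivity
  refine ⟨Real.sqrt Z, Real.sqrt_nonneg Z, fun j L hL => ?_⟩
  -- restart the level at a good time `s₀`
  obtain ⟨s₀, hs₀, -, hw⟩ := (hLH j).exists_isGlobalLerayHopf_translate hg (hν j).le
  -- the pincer along the restarted solution
  obtain ⟨K, hK0, hK⟩ := shellPincer_of_singleShell (hν j) hg hm hshell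
    ((hLH j).memLp_two hs₀.le) hw
  have hνj : 0 < ν j := hν j
  set c : ℝ := 8 * Real.pi ^ 2 * m * ν j with hc
  have hc0 : 0 < c := by rw [hc]; positivity
  -- transient `≤ 1` after waiting `K / c`
  have htrans : ∀ t : ℝ, 1 + K / c ≤ t → K * Real.exp (-c * (t - 1)) ≤ 1 := by
    intro t ht
    have h1 : K ≤ c * (t - 1) := by
      have : K / c ≤ t - 1 := by linarith
      rwa [div_le_iff₀ hc0, mul_comm] at this
    have h2 : 1 + c * (t - 1) ≤ Real.exp (c * (t - 1)) := by
      have := Real.add_one_le_exp (c * (t - 1)); linarith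
    have h3 : 0 < Real.exp (c * (t - 1)) := Real.exp_pos _
    rw [show -c * (t - 1) = -(c * (t - 1)) by ring, Real.exp_neg]
    rw [mul_inv_le_iff₀ h3]
    nlinarith
  -- a good phase beyond `s₀ + 1 + K/c`
  have hKc : 0 ≤ K / c := div_nonneg hK0 hc0.le
  have hA : 0 ≤ s₀ + 1 + K / c := by linarith
  obtain ⟨s, hAs, hgood⟩ := exists_goodPhase_energy (hν j) hg hgm (hLH j) (hE j) hA
  have hs : 0 ≤ s := hA.trans hAs
  refine ⟨s, hs, ?_⟩
  -- pointwise enstrophy bound on the window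
  set Ef : ℝ → ℝ := fun t => ∫ x, ‖v j t x‖ ^ 2 with hEf
  have hpt : ∀ τ : ℝ, 0 < τ → eGradNormSq (v j (s + τ)) ≤ ENNReal.ofReal (Λ * Ef (s + τ) + 1) := by
    intro τ hτ
    have ht1 : 1 ≤ s + τ - s₀ := by linarith
    have hpin := hK (s + τ - s₀) ht1
    have e1 : s + τ - s₀ + s₀ = s + τ := by ring
    simp only [e1] at hpin
    refine hpin.trans (ENNReal.ofReal_le_ofReal ?_)
    have := htrans (s + τ - s₀) (by linarith)
    rw [hΛ]
    have e2 : -(8 * Real.pi ^ 2 * m * ν j) * (s + τ - s₀ - 1) = -c * (s + τ - s₀ - 1) := by rw [hc]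
    rw [e2]
    linarith
  -- integrability of the shifted energy on the window
  have hEi : IntervalIntegrable Ef volume s (s + L) :=
    (intervalIntegrable_iff_integrableOn_Ioc_of_le (by linarith)).2
      ((hLH j).integrableOn_integral_norm_sq (by linarith : 0 < s + L) |>.mono_set
        (Ioc_subset_Ioc_left hs))
  have hEi' : IntegrableOn (fun τ => Ef (s + τ)) (Ioo 0 L) := by
    have h1 : IntervalIntegrable (fun τ => Ef (s + τ)) volume (s - s) (s + L - s) :=
      hEi.comp_add_left s |>.symm.symm
    rw [sub_self, add_sub_cancel_left] at h1
    exact ((intervalIntegrable_iff_integrableOn_Ioo_of_le hL.le).1 h1)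
  have hE0 : ∀ t, 0 ≤ Ef t := fun t => integral_nonneg fun _ => sq_nonneg _
  -- the window integral of the enstrophy
  have hwin : ∫⁻ τ in Ioo 0 L, eGradNormSq (v j (s + τ)) ≤ ENNReal.ofReal (Z * L) := by
    have hfi : Integrable (fun τ => Λ * Ef (s + τ) + 1) (volume.restrict (Ioo 0 L)) :=
      (hEi'.const_mul Λ).add (integrableOn_const (by rw [Real.volume_Ioo]; exact ENNReal.ofReal_ne_top))
    have hnn : 0 ≤ᵐ[volume.restrict (Ioo 0 L)] fun τ => Λ * Ef (s + τ) + 1 :=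
      Eventually.of_forall fun τ => by have := hE0 (s + τ); positivity
    calc ∫⁻ τ in Ioo 0 L, eGradNormSq (v j (s + τ))
        ≤ ∫⁻ τ in Ioo 0 L, ENNReal.ofReal (Λ * Ef (s + τ) + 1) :=
          setLIntegral_mono' measurableSet_Ioo fun τ hτ => hpt τ hτ.1
      _ = ENNReal.ofReal (∫ τ in Ioo 0 L, (Λ * Ef (s + τ) + 1)) :=
          (ofReal_integral_eq_lintegral_ofReal hfi hnn).symm
      _ ≤ ENNReal.ofReal (Z * L) := by
          refine ENNReal.ofReal_le_ofReal ?_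
          rw [integral_add (hEi'.const_mul Λ) (integrableOn_const (by rw [Real.volume_Ioo]; exact ENNReal.ofReal_ne_top)),
            integral_const_mul]
          have h1 : ∫ τ in Ioo 0 L, Ef (s + τ) ≤ B * L := by
            have e : ∫ τ in Ioo 0 L, Ef (s + τ) = ∫ τ in s..(s + L), Ef τ := by
              rw [← integral_Ioc_eq_integral_Ioo, ← intervalIntegral.integral_of_le hL.le,
                intervalIntegral.integral_comp_add_left (fun τ => Ef τ) s, add_zero]
            rw [e]; exact hgood L hL.le
          have h2 : ∫ _ in Ioo 0 L, (1 : ℝ) = L := by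
            rw [setIntegral_const, smul_eq_mul, mul_one, measureReal_def, Real.volume_Ioo, sub_zero,
              ENNReal.toReal_ofReal hL.le]
          rw [h2, hZ]
          nlinarith
  -- Cauchy–Schwarz on the window
  have hm : AEStronglyMeasurable (uncurry fun τ => v j (s + τ))
      (((volume : Measure ℝ).restrict (Ioo 0 L)).prod volume) := by
    have h1 := aestronglyMeasurable_stLift_translate hs le_rfl ((hLH j) (L + s) (by linarith)).weak.1
    have e : (fun τ => v j (τ + s)) = fun τ => v j (s + τ) := by funext τ; rw [add_comm]
    rw [e] at h1
    have h2 := Literature.Analysis.FunctionSpaces.Torus.aestronglyMeasurable_uncurry_of_stLift_restrict h1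
    rwa [volume_restrict_prod_eq] at h2
  have hf : AEMeasurable (fun τ => eGradNormSq (v j (s + τ))) (volume.restrict (Ioo 0 L)) :=
    aemeasurable_eGradNormSq_slice hm
  calc ∫⁻ τ in Ioo 0 L, eGradNormSq (v j (s + τ)) ^ (1 / 2 : ℝ)
      ≤ (∫⁻ τ in Ioo 0 L, eGradNormSq (v j (s + τ))) ^ (1 / 2 : ℝ) * ENNReal.ofReal L ^ (1 / 2 : ℝ) :=
        setLIntegral_rpow_half_le hf
    _ ≤ ENNReal.ofReal (Z * L) ^ (1 / 2 : ℝ) * ENNReal.ofReal L ^ (1 / 2 : ℝ) := by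
        gcongr
    _ = ENNReal.ofReal (Real.sqrt (Z * L) * Real.sqrt L) := by
        rw [ofReal_rpow_half_eq_ofReal_sqrt, ofReal_rpow_half_eq_ofReal_sqrt,
          ENNReal.ofReal_mul (Real.sqrt_nonneg _)]
    _ ≤ ENNReal.ofReal (Real.sqrt Z * (1 + L)) := by
        refine ENNReal.ofReal_le_ofReal ?_
        rw [Real.sqrt_mul hZ0]
        have h1 : Real.sqrt L * Real.sqrt L = L := Real.mul_self_sqrt hL.le
        have h3 := Real.sqrt_nonneg Z
        have h4 := Real.sqrt_nonneg L
        calc Real.sqrt Z * Real.sqrt L * Real.sqrt L = Real.sqrt Z * L := by rw [mul_assoc, h1]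
          _ ≤ Real.sqrt Z * (1 + L) := by gcongr; linarith

/-! ## Quasi-laminar windows: windowed mean enstrophy bounded (planar dissipation `O(ν)`) -/

/-- **Quasi-laminar windows**: one constant `c` such that every level and every window length have a
phase `s ≥ 0` with windowed MEAN enstrophy `∫₀ᴸ ‖∇v_j(s+τ)‖₂² dτ ≤ c (1 + L)` — i.e. windowed planar
energy dissipation `ν_j L⁻¹∫ₛ^{s+L}‖∇v_j‖² = O(ν_j)`, the laminar scaling (single-shell forcing, steady
states, Galerkin / band-limited stirring; Alexakis–Doering allow up to `O(ν^{1/2})` in general). -/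
def QuasiLaminarWindows (_g : 𝕋² → E²) (_h : 𝕋² → ℝ) (_ν : ℕ → ℝ) (v : ℕ → ℝ → 𝕋² → E²) : Prop :=
  ∃ c : ℝ, 0 ≤ c ∧ ∀ (j : ℕ) (L : ℝ), 0 < L → ∃ s : ℝ, 0 ≤ s ∧
    ∫⁻ τ in Ioo 0 L, eGradNormSq (v j (s + τ)) ≤ ENNReal.ofReal (c * (1 + L))

/-- Cauchy–Schwarz on a window along a Leray–Hopf drift: a bound `W` on the windowed mean enstrophy
from phase `s` bounds the windowed strain by `√W √L`. [folklore] -/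
theorem lintegral_strain_le_of_enstrophy {ν : ℝ} {g u₀ : 𝕋² → E²} {u : ℝ → 𝕋² → E²}
    (hu : IsGlobalLerayHopf ν (fun _ => g) u₀ u) {s L W : ℝ} (hs : 0 ≤ s) (hL : 0 < L)
    (hW : ∫⁻ τ in Ioo 0 L, eGradNormSq (u (s + τ)) ≤ ENNReal.ofReal W) :
    ∫⁻ τ in Ioo 0 L, eGradNormSq (u (s + τ)) ^ (1 / 2 : ℝ) ≤
      ENNReal.ofReal (Real.sqrt W * Real.sqrt L) := by
  have hm : AEStronglyMeasurable (uncurry fun τ => u (s + τ))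
      (((volume : Measure ℝ).restrict (Ioo 0 L)).prod volume) := by
    have h1 := aestronglyMeasurable_stLift_translate hs le_rfl ((hu (L + s) (by linarith))).weak.1
    have e : (fun τ => u (τ + s)) = fun τ => u (s + τ) := by funext τ; rw [add_comm]
    rw [e] at h1
    have h2 := Literature.Analysis.FunctionSpaces.Torus.aestronglyMeasurable_uncurry_of_stLift_restrict h1
    rwa [volume_restrict_prod_eq] at h2
  have hf : AEMeasurable (fun τ => eGradNormSq (u (s + τ))) (volume.restrict (Ioo 0 L)) :=
    aemeasurable_eGradNormSq_slice hm
  calc ∫⁻ τ in Ioo 0 L, eGradNormSq (u (s + τ)) ^ (1 / 2 : ℝ)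
      ≤ (∫⁻ τ in Ioo 0 L, eGradNormSq (u (s + τ))) ^ (1 / 2 : ℝ) * ENNReal.ofReal L ^ (1 / 2 : ℝ) :=
        setLIntegral_rpow_half_le hf
    _ ≤ ENNReal.ofReal W ^ (1 / 2 : ℝ) * ENNReal.ofReal L ^ (1 / 2 : ℝ) := by gcongr
    _ = ENNReal.ofReal (Real.sqrt W * Real.sqrt L) := by
        rw [ofReal_rpow_half_eq_ofReal_sqrt, ofReal_rpow_half_eq_ofReal_sqrt,
          ENNReal.ofReal_mul (Real.sqrt_nonneg _)]

/-- **`RelaxingFamily` is false with quasi-laminar windows** (unconditional): a witness of crux r3 has a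
window length `L*` with `sup_j inf_{s ≥ 0} ∫ₛ^{s+L*} ‖∇v_j‖₂² = ∞` — windowed planar energy dissipation
`≫ ν_j` in EVERY window of length `L*` at suitable levels (Cauchy–Schwarz into `TamePhases`).
[cite: Seis2022, Remark 1 (arXiv:2003.08794 p. 4)] -/
theorem relaxingFamily_false_with_quasiLaminarWindows :
    ¬ RelaxingFamilyUnder QuasiLaminarWindows := by
  rintro ⟨g, h, hg, hgd, hgm, hh, hhm, hh0, ν, v₀, v, hν, hνlim, hLH, hbd, hE, ⟨c, hc, hq⟩, hrest⟩
  refine relaxingFamily_false_with_tamePhases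
    ⟨g, h, hg, hgd, hgm, hh, hhm, hh0, ν, v₀, v, hν, hνlim, hLH, hbd, hE, fun L hL => ?_, hrest⟩
  refine ⟨Real.sqrt (c * (1 + L)) * Real.sqrt L, fun j => ?_⟩
  obtain ⟨s, hs, hW⟩ := hq j L hL
  exact ⟨s, hs, lintegral_strain_le_of_enstrophy (hLH j) hs hL hW⟩

/-- **X is false with quasi-laminar windows** (transferred): an X-witness dissipates planar energy at
rate `≫ ν_j` in every window of some fixed length, at suitable levels. [cite: Seis2022, Remark 1 (arXiv:2003.08794 p. 4)] -/
theorem uniformRelaxationWitness_false_with_quasiLaminarWindows :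
    ¬ UniformRelaxationWitnessUnder QuasiLaminarWindows := fun hX =>
  relaxingFamily_false_with_quasiLaminarWindows hX.relaxingFamilyUnder

/-! ## The theorems -/

/-- **`RelaxingFamily` (crux r3) is false for single-shell forcing** (unconditional): no witness of
`RelaxingFamily` has its steady force on one Fourier shell — such a family has a `j`-uniform windowed
strain budget (`windowedStrainBudget_of_singleShell`), excluded by Seis' windowed floor. The Lean form of
the route's design rule "the planar force must span at least two shells". [cite: Seis2022, Thm 2 and Remark 1 (arXiv:2003.08794 pp. 3–4)] -/
theorem relaxingFamily_false_with_singleShell :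
    ¬ RelaxingFamilyUnder (fun g _ _ _ => IsSingleShell g) := by
  rintro ⟨g, h, hg, hgd, hgm, hh, hhm, hh0, ν, v₀, v, hν, hνlim, hLH, hbd, ⟨E, hE⟩, hH, hrest⟩
  exact relaxingFamily_false_without_superlinearWindowedStrain
    ⟨g, h, hg, hgd, hgm, hh, hhm, hh0, ν, v₀, v, hν, hνlim, hLH, hbd, ⟨E, hE⟩,
      windowedStrainBudget_of_singleShell hg hgm hH hν hLH hE, hrest⟩

/-- **`UniformRelaxationWitness` (crux r2 = X) is false for single-shell forcing** (unconditional).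
[cite: Seis2022, Thm 2 and Remark 1 (arXiv:2003.08794 pp. 3–4)] -/
theorem uniformRelaxationWitness_false_with_singleShell :
    ¬ UniformRelaxationWitnessUnder (fun g _ _ _ => IsSingleShell g) := fun hX =>
  relaxingFamily_false_with_singleShell hX.relaxingFamilyUnder

/-- **X is false with tame phases** (the windowed Seis floor, transferred): an X-witness has a window
length `L*` with `sup_j inf_{s ≥ 0} ∫ₛ^{s+L*} ‖∇v_j‖₂ = ∞`. [cite: Seis2022, Remark 1 (arXiv:2003.08794 p. 4)] -/
theorem uniformRelaxationWitness_false_with_tamePhases :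
    ¬ UniformRelaxationWitnessUnder TamePhases := fun hX =>
  relaxingFamily_false_with_tamePhases hX.relaxingFamilyUnder

/-- **X is false without super-linear windowed strain** (transferred). [cite: Seis2022, Remark 1 (arXiv:2003.08794 p. 4)] -/
theorem uniformRelaxationWitness_false_without_superlinearWindowedStrain :
    ¬ UniformRelaxationWitnessUnder WindowedStrainBudget := fun hX =>
  relaxingFamily_false_without_superlinearWindowedStrain hX.relaxingFamilyUnder

/-- **X is false with initially tame strain** ("the data must be pre-stirred", transferred): no
X-witness has `j`-uniformly bounded strain on every initial window. [cite: Seis2022, Remark 1 (arXiv:2003.08794 p. 4)] -/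
theorem uniformRelaxationWitness_false_with_initiallyTame :
    ¬ UniformRelaxationWitnessUnder InitiallyTame := fun hX =>
  relaxingFamily_false_with_initiallyTame hX.relaxingFamilyUnder

/-! # Part E — Line `Sketch`: exact recurrent states (landed: `Negative/RecurrentStates.lean`, p102625) -/

/-! ## The relaxation clause from a set of phases; periodic phase reduction -/

/-- The `(U_h)` clause with the admissible release phases restricted to `S ⊆ ℝ` (the line's
`RelaxesUniformlyFrom`, re-declared: crux workfiles are not importable). -/
def RelaxesUniformlyFrom (κ : ℝ) (u : ℝ → 𝕋² → E²) (h : 𝕋² → ℝ) (C γ : ℝ) (S : Set ℝ) : Prop :=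
  ∀ s ∈ S, ∀ (T : ℝ) (θ : ℝ → 𝕋² → ℝ),
    IsWeakScalarTransportOn T κ (fun t => u (s + t)) h θ →
      ∀ᵐ t ∂(volume.restrict (Ioo (0 : ℝ) T)),
        scalarL2Sq (θ t) ≤ C * Real.exp (-(γ * t)) * scalarL2Sq h

/-- **Periodic phase reduction** (the line's proved glue, re-proved here): for a `T₀`-periodic drift the
clause from the phases of one period `[0, T₀]` is the clause from every phase `s ≥ 0`, same constants
(the equation released at phase `s` is literally the one released at `s mod T₀`). [folklore] -/
theorem relaxesUniformlyFrom_Ici_of_periodic {κ : ℝ} {u : ℝ → 𝕋² → E²} {h : 𝕋² → ℝ} {C γ T₀ : ℝ}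
    (hT₀ : 0 < T₀) (hper : Function.Periodic u T₀)
    (hU : RelaxesUniformlyFrom κ u h C γ (Icc 0 T₀)) :
    RelaxesUniformlyFrom κ u h C γ (Ici 0) := by
  intro s _ T θ hθ
  set s' := toIcoMod hT₀ 0 s with hs'
  have hs'mem : s' ∈ Ico (0 : ℝ) (0 + T₀) := toIcoMod_mem_Ico hT₀ 0 s
  have hshift : (fun t => u (s + t)) = fun t => u (s' + t) := by
    funext t
    have h1 : s' = s - toIcoDiv hT₀ 0 s • T₀ := by rw [hs', self_sub_toIcoDiv_zsmul]
    rw [h1, zsmul_eq_mul]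
    have := (hper.int_mul (toIcoDiv hT₀ 0 s)).sub_eq (s + t)
    rw [show s - (toIcoDiv hT₀ 0 s : ℝ) * T₀ + t = s + t - (toIcoDiv hT₀ 0 s : ℝ) * T₀ by ring]
    exact this.symm
  have hs'Icc : s' ∈ Icc (0 : ℝ) T₀ := ⟨hs'mem.1, by simpa only [zero_add] using hs'mem.2.le⟩
  rw [hshift] at hθ
  exact hU s' hs'Icc T θ hθ

/-! ## The line's class with an extra hypothesis -/

/-- **The transfer class of line `Sketch` under an extra hypothesis.** Exact time-periodic steadily
forced planar Leray–Hopf states: steady smooth solenoidal mean-zero `g`, smooth mean-zero `h`,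
`ν_j → 0`, periods `0 < T_j ≤ T₀`, global Leray–Hopf `v_j` with `v_j(t + T_j) = v_j(t)`, local
boundedness, POINTWISE energy `∫‖v_j(t)‖² ≤ E` on `t ≥ 0`, the relaxation clause from the phases of one
period with `ν`-uniform `(C, γ)`, the absorption floor — the registered stub
`RecurrentSymmetricStates` of `Cruxes/UniformRelaxationWitness/Lines/Sketch.lean` with its two
point-symmetry conjuncts DROPPED (weaker class) — plus `Hyp g h ν T v`. -/
def RecurrentStatesUnder
    (Hyp : (𝕋² → E²) → (𝕋² → ℝ) → (ℕ → ℝ) → (ℕ → ℝ) → (ℕ → ℝ → 𝕋² → E²) → Prop) : Prop :=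
  ∃ (g : 𝕋² → E²) (h : 𝕋² → ℝ), IsSmooth g ∧ IsDivFree g ∧ HasZeroMean g ∧
    IsSmooth h ∧ HasZeroMean h ∧
    ∃ (ν T : ℕ → ℝ) (T₀ E : ℝ) (v₀ : ℕ → 𝕋² → E²) (v : ℕ → ℝ → 𝕋² → E²),
      (∀ j, 0 < ν j) ∧ Tendsto ν atTop (𝓝 0) ∧ (∀ j, 0 < T j ∧ T j ≤ T₀) ∧
      (∀ j, IsGlobalLerayHopf (ν j) (fun _ => g) (v₀ j) (v j)) ∧
      (∀ j (T' : ℝ), 0 < T' →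
        MemLp (stLift (v j)) ⊤ (volume.restrict (Ioo (0 : ℝ) T' ×ˢ univ))) ∧
      (∀ j, Function.Periodic (v j) (T j)) ∧
      (∀ j t, 0 ≤ t → ∫⁻ x, ‖v j t x‖ₑ ^ 2 ≤ ENNReal.ofReal E) ∧
      Hyp g h ν T v ∧
      (∃ C γ : ℝ, 0 ≤ C ∧ 0 < γ ∧ ∀ j, RelaxesUniformlyFrom (ν j) (v j) h C γ (Icc 0 (T j))) ∧
      ∃ ε : ℝ, 0 < ε ∧ ∀ j, ∃ θ : ℝ → 𝕋² → ℝ,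
        IsWeakScalarTransportForced (ν j) (v j) (fun _ => h) 0 θ ∧
        ε ≤ longTimeAvgSup (fun t => ν j * (eScalarGradNormSq (θ t)).toReal)

/-- The periodic data of a recurrent state, remembered as an extra hypothesis on the X-witness it yields. -/
def PeriodicData (Hyp : (𝕋² → E²) → (𝕋² → ℝ) → (ℕ → ℝ) → (ℕ → ℝ) → (ℕ → ℝ → 𝕋² → E²) → Prop)
    (g : 𝕋² → E²) (h : 𝕋² → ℝ) (ν : ℕ → ℝ) (v : ℕ → ℝ → 𝕋² → E²) : Prop :=
  ∃ (T : ℕ → ℝ) (T₀ E : ℝ), (∀ j, 0 < T j ∧ T j ≤ T₀) ∧ (∀ j, Function.Periodic (v j) (T j)) ∧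
    (∀ j t, 0 ≤ t → ∫⁻ x, ‖v j t x‖ₑ ^ 2 ≤ ENNReal.ofReal E) ∧ Hyp g h ν T v

/-- **The line's transfer, kept honest**: a recurrent state under `Hyp` is an X-witness under
`PeriodicData Hyp` (periodic phase reduction + `stub_meanEnergyGlue`). [folklore] -/
theorem RecurrentStatesUnder.uniformRelaxationWitnessUnder
    {Hyp : (𝕋² → E²) → (𝕋² → ℝ) → (ℕ → ℝ) → (ℕ → ℝ) → (ℕ → ℝ → 𝕋² → E²) → Prop}
    (hR : RecurrentStatesUnder Hyp) : UniformRelaxationWitnessUnder (PeriodicData Hyp) := by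
  obtain ⟨g, h, hg, hgd, hgm, hh, hhm, ν, T, T₀, E, v₀, v, hν, hνlim, hT, hLH, hbd, hper, hE, hH,
    ⟨C, γ, hC, hγ, hU⟩, hfloor⟩ := hR
  refine ⟨g, h, hg, hgd, hgm, hh, hhm, ν, v₀, v, hν, hνlim, hLH, hbd,
    ⟨max E 0, fun j =>
      Summit.AnomalousDissipation.AnomalousDissipation.Theorems.stub_meanEnergyGlue (v j) E (hE j)⟩,
    ⟨T, T₀, E, hT, hper, hE, hH⟩,
    ⟨C, γ, hC, hγ, fun j s hs T' θ hθ => ?_⟩, hfloor⟩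
  exact relaxesUniformlyFrom_Ici_of_periodic (hT j).1 (hper j) (hU j) s (mem_Ici.2 hs) T' θ hθ

/-! ## Periodic windows: a per-period strain bound is a linear budget -/

/-- Lower integral of a `P`-periodic function over `n` periods. [folklore] -/
theorem setLIntegral_Ioc_periodic (φ : ℝ → ℝ≥0∞) {P : ℝ} (hP : 0 < P) (hφ : Function.Periodic φ P)
    (n : ℕ) : ∫⁻ t in Ioc 0 ((n : ℝ) * P), φ t = n * ∫⁻ t in Ioc 0 P, φ t := by
  induction n with
  | zero => simp
  | succ n ih =>
    have hsplit : Ioc (0 : ℝ) (((n : ℝ) + 1) * P) = Ioc 0 ((n : ℝ) * P) ∪ Ioc ((n : ℝ) * P) ((n : ℝ) * P + P) := by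
      rw [Ioc_union_Ioc_eq_Ioc (by positivity) (by linarith), add_one_mul]
    have hdisj : Disjoint (Ioc (0 : ℝ) ((n : ℝ) * P)) (Ioc ((n : ℝ) * P) ((n : ℝ) * P + P)) :=
      disjoint_left.2 fun t ht ht' => (not_lt.2 ht.2) ht'.1
    have hshift : ∫⁻ t in Ioc ((n : ℝ) * P) ((n : ℝ) * P + P), φ t = ∫⁻ t in Ioc 0 P, φ t := by
      rw [setLIntegral_congr Ioo_ae_eq_Ioc.symm, setLIntegral_congr Ioo_ae_eq_Ioc.symm]
      have h1 := setLIntegral_Ioo_add_left φ 0 P ((n : ℝ) * P)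
      rw [add_zero] at h1
      rw [← h1]
      refine lintegral_congr fun t => ?_
      have := (hφ.nat_mul n) t
      rw [add_comm] at this
      exact this
    push_cast
    rw [hsplit, lintegral_union measurableSet_Ioc hdisj, ih, hshift, add_mul, one_mul]

/-- **Bounded per-period mean strain**: one `S ≥ 0` with `∫₀^{T_j} ‖∇v_j(τ)‖_{L²} dτ ≤ S T_j` for
every level (`‖∇w‖_{L²} = (eGradNormSq w)^{1/2}`). -/
def BoundedPeriodStrain (_g : 𝕋² → E²) (_h : 𝕋² → ℝ) (_ν : ℕ → ℝ) (T : ℕ → ℝ)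
    (v : ℕ → ℝ → 𝕋² → E²) : Prop :=
  ∃ S : ℝ, 0 ≤ S ∧ ∀ j, ∫⁻ τ in Ioo 0 (T j), eGradNormSq (v j τ) ^ (1 / 2 : ℝ) ≤ ENNReal.ofReal (S * T j)

/-- **For periodic drifts with pointwise energy `≤ E` and periods `≤ T₀`, a per-period strain bound
`S` is a linear windowed enstrophy budget from phase `0`** (slope `S (1 + T₀)`: a window `(0,t)` is
covered by `⌈t/T_j⌉ ≤ t/T_j + 1` periods). [folklore] -/
theorem linearEnstrophyBudget_of_boundedPeriodStrain {g : 𝕋² → E²} {h : 𝕋² → ℝ} {ν : ℕ → ℝ}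
    {v : ℕ → ℝ → 𝕋² → E²} (hP : PeriodicData BoundedPeriodStrain g h ν v) :
    LinearEnstrophyBudget g h ν v := by
  obtain ⟨T, T₀, E, hT, hper, hE, S, hS, hstrain⟩ := hP
  have hT₀ : 0 < T₀ := (hT 0).1.trans_le (hT 0).2
  refine ⟨S * (1 + T₀), by positivity, fun j => ⟨0, le_rfl, ⟨Real.toNNReal E, ?_⟩, fun t ht => ?_⟩⟩
  · filter_upwards [ae_restrict_mem measurableSet_Ioi] with t ht
    rw [zero_add]
    exact hE j t (le_of_lt ht)
  · obtain ⟨hTj, hTjT₀⟩ := hT j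
    set φ : ℝ → ℝ≥0∞ := fun τ => eGradNormSq (v j τ) ^ (1 / 2 : ℝ) with hφ
    have hφper : Function.Periodic φ (T j) := fun τ => by
      simp only [hφ, hper j τ]
    set n : ℕ := ⌈t / T j⌉₊ with hn
    have htn : t ≤ (n : ℝ) * T j := by
      have := Nat.le_ceil (t / T j)
      rw [div_le_iff₀ hTj] at this
      exact this
    have hn1 : (n : ℝ) ≤ t / T j + 1 := (Nat.ceil_lt_add_one (by positivity)).le
    calc ∫⁻ τ in Ioo 0 t, eGradNormSq (v j (0 + τ)) ^ (1 / 2 : ℝ)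
        = ∫⁻ τ in Ioo 0 t, φ τ := by simp only [zero_add, hφ]
      _ ≤ ∫⁻ τ in Ioc 0 ((n : ℝ) * T j), φ τ := lintegral_mono_set (Ioo_subset_Ioc_self.trans (Ioc_subset_Ioc_right htn))
      _ = n * ∫⁻ τ in Ioc 0 (T j), φ τ := setLIntegral_Ioc_periodic φ hTj hφper n
      _ = n * ∫⁻ τ in Ioo 0 (T j), φ τ := by rw [setLIntegral_congr Ioo_ae_eq_Ioc]
      _ ≤ n * ENNReal.ofReal (S * T j) := by gcongr; exact hstrain j
      _ = ENNReal.ofReal ((n : ℝ) * (S * T j)) := by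
          rw [ENNReal.ofReal_mul (Nat.cast_nonneg n), ENNReal.ofReal_natCast]
      _ ≤ ENNReal.ofReal (S * (1 + T₀) * (1 + t)) := by
          refine ENNReal.ofReal_le_ofReal ?_
          have h1 : (n : ℝ) * (S * T j) ≤ (t / T j + 1) * (S * T j) :=
            mul_le_mul_of_nonneg_right hn1 (by positivity)
          have h2 : (t / T j + 1) * (S * T j) = S * t + S * T j := by field_simp
          have h3 : S * T j ≤ S * T₀ := mul_le_mul_of_nonneg_left hTjT₀ hS
          nlinarith [mul_nonneg hS ht.le, mul_nonneg hS hT₀.le, mul_nonneg (mul_nonneg hS hT₀.le) ht.le]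

/-! ## The theorems -/

/-- **Recurrent states need unbounded per-period strain** (unconditional): no witness of the line's
class has `j`-uniformly bounded per-period mean strain `T_j⁻¹∫₀^{T_j}‖∇v_j‖_{L²} ≤ S`. Any proof of
`stub_recurrentSymmetricStates` must therefore exhibit exact periodic Navier–Stokes states with
per-period mean strain `→ ∞` along `ν_j → 0` (sharp Seis: `≳ γ log(1/ν_j)`) at pointwise energy `≤ E`
and periods `≤ T₀`. [cite: Seis2022, Thm 2 and Remark 1 (arXiv:2003.08794 pp. 3–4)] -/
theorem recurrentStates_false_without_unboundedPeriodStrain :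
    ¬ RecurrentStatesUnder BoundedPeriodStrain := fun hR =>
  uniformRelaxationWitness_false_without_superlinearEnstrophy
    (hR.uniformRelaxationWitnessUnder.mono fun _ _ _ _ => linearEnstrophyBudget_of_boundedPeriodStrain)

/-- **Recurrent states are subject to Seis' floor**: no witness of the line's class admits a
`j`-uniform linear windowed enstrophy budget from some phase on. [cite: Seis2022, Remark 1 (arXiv:2003.08794 p. 4)] -/
theorem recurrentStates_false_without_superlinearEnstrophy :
    ¬ RecurrentStatesUnder (fun g h ν _ v => LinearEnstrophyBudget g h ν v) := fun hR =>
  uniformRelaxationWitness_false_without_superlinearEnstrophy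
    (hR.uniformRelaxationWitnessUnder.mono fun _ _ _ _ ⟨_, _, _, _, _, _, hH⟩ => hH)

/-- **Recurrent states need unbounded enstrophy**: no witness of the line's class has `j`-uniformly
(essentially) bounded enstrophy from some phase on. [cite: Seis2022, Thm 2 (arXiv:2003.08794 pp. 3–4)] -/
theorem recurrentStates_false_without_unboundedEnstrophy :
    ¬ RecurrentStatesUnder (fun g h ν _ v => BoundedEnstrophy g h ν v) := fun hR =>
  uniformRelaxationWitness_false_without_unboundedEnstrophy
    (hR.uniformRelaxationWitnessUnder.mono fun _ _ _ _ ⟨_, _, _, _, _, _, hH⟩ => hH)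

/-! # Part F — decaying turbulence (`g = 0`) is dead (filed: `Negative/Unforced.lean`) -/

/-- **Unforced Leray–Hopf solutions have time-integrable enstrophy**: for the zero force,
`∫⁻_{(0,t)} ‖∇u‖₂² ≤ ofReal (kineticEnergy u₀ / ν)` for every `t > 0` (the energy inequality from `0`;
the work term vanishes). [folklore] -/
theorem lintegral_eGradNormSq_le_of_unforced {ν : ℝ} (hν : 0 < ν) {u₀ : 𝕋² → E²} {u : ℝ → 𝕋² → E²}
    (hu : IsGlobalLerayHopf ν (fun _ => (0 : 𝕋² → E²)) u₀ u) {t : ℝ} (ht : 0 < t) :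
    ∫⁻ τ in Ioo 0 t, eGradNormSq (u τ) ≤ ENNReal.ofReal (kineticEnergy u₀ / ν) := by
  have hLH := hu t ht
  have hE := hLH.energy_ineq_zero t ⟨ht.le, le_rfl⟩
  have hwork : ∫ τ in (0 : ℝ)..t, ∫ x, ⟪(fun _ : ℝ => (0 : 𝕋² → E²)) τ x, u τ x⟫_ℝ = 0 := by simp
  rw [hwork, add_zero] at hE
  have hfin : ∫⁻ τ in Ioo 0 t, eGradNormSq (u τ) ≠ ⊤ := hLH.lintegral_eGradNormSq_lt_top.ne
  have hK : 0 ≤ kineticEnergy (u t) := kineticEnergy_nonneg _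
  have h1 : ν * (∫⁻ τ in Ioo 0 t, eGradNormSq (u τ)).toReal ≤ kineticEnergy u₀ := by linarith
  have h2 : (∫⁻ τ in Ioo 0 t, eGradNormSq (u τ)).toReal ≤ kineticEnergy u₀ / ν := by
    rw [le_div_iff₀ hν, mul_comm]; exact h1
  exact (ENNReal.le_ofReal_iff_toReal_le hfin (h2.trans' ENNReal.toReal_nonneg |> fun h => by
    exact div_nonneg ((mul_nonneg hν.le ENNReal.toReal_nonneg).trans h1) hν.le)).2 h2

/-- **`g = 0` ⇒ quasi-laminar windows (constant `1`)**: along a family of UNFORCED global planar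
Leray–Hopf solutions every level has, for every window length `L`, a phase `s = nL` with windowed mean
enstrophy `∫₀ᴸ‖∇v_j(s+τ)‖² dτ ≤ 1 ≤ 1 + L` — pigeonhole over the consecutive windows `(nL, (n+1)L]`,
whose enstrophies sum to at most `kineticEnergy(v₀_j)/ν_j`. [folklore] -/
theorem quasiLaminarWindows_of_unforced {h : 𝕋² → ℝ} {ν : ℕ → ℝ} {v₀ : ℕ → 𝕋² → E²}
    {v : ℕ → ℝ → 𝕋² → E²} (hν : ∀ j, 0 < ν j)
    (hLH : ∀ j, IsGlobalLerayHopf (ν j) (fun _ => (0 : 𝕋² → E²)) (v₀ j) (v j)) :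
    QuasiLaminarWindows 0 h ν v := by
  refine ⟨1, zero_le_one, fun j L hL => ?_⟩
  set G : ℝ → ℝ≥0∞ := fun τ => eGradNormSq (v j τ) with hG
  set Q : ℝ := kineticEnergy (v₀ j) / ν j with hQ
  have hQ0 : 0 ≤ Q := div_nonneg (kineticEnergy_nonneg _) (hν j).le
  -- cumulative enstrophy over `n` windows
  have hcum : ∀ n : ℕ, 0 < n → ∫⁻ τ in Ioc 0 ((n : ℝ) * L), G τ ≤ ENNReal.ofReal Q := by
    intro n hn
    have hnL : 0 < (n : ℝ) * L := by positivity
    calc ∫⁻ τ in Ioc 0 ((n : ℝ) * L), G τ = ∫⁻ τ in Ioo 0 ((n : ℝ) * L), G τ := by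
          rw [setLIntegral_congr Ioo_ae_eq_Ioc]
      _ ≤ ENNReal.ofReal Q := lintegral_eGradNormSq_le_of_unforced (hν j) (hLH j) hnL
  -- the increments
  have hsplit : ∀ n : ℕ, ∫⁻ τ in Ioc 0 (((n : ℝ) + 1) * L), G τ =
      (∫⁻ τ in Ioc 0 ((n : ℝ) * L), G τ) + ∫⁻ τ in Ioc ((n : ℝ) * L) (((n : ℝ) + 1) * L), G τ := by
    intro n
    have hun : Ioc (0 : ℝ) (((n : ℝ) + 1) * L) = Ioc 0 ((n : ℝ) * L) ∪ Ioc ((n : ℝ) * L) (((n : ℝ) + 1) * L) := by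
      rw [Ioc_union_Ioc_eq_Ioc (by positivity) (by nlinarith)]
    have hdisj : Disjoint (Ioc (0 : ℝ) ((n : ℝ) * L)) (Ioc ((n : ℝ) * L) (((n : ℝ) + 1) * L)) :=
      disjoint_left.2 fun t ht ht' => (not_lt.2 ht.2) ht'.1
    rw [hun, lintegral_union measurableSet_Ioc hdisj]
  -- pigeonhole: some window among the first `N = ⌊Q⌋₊ + 1` has enstrophy `≤ 1`
  set N : ℕ := ⌊Q⌋₊ + 1 with hN
  by_contra hcon
  push Not at hcon
  have hbig : ∀ n : ℕ, 1 < ∫⁻ τ in Ioc ((n : ℝ) * L) (((n : ℝ) + 1) * L), G τ := by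
    intro n
    by_contra hle
    push Not at hle
    have e : ∫⁻ τ in Ioo 0 L, G ((n : ℝ) * L + τ) = ∫⁻ τ in Ioo ((n : ℝ) * L) ((n : ℝ) * L + L), G τ := by
      have := setLIntegral_Ioo_add_left G 0 L ((n : ℝ) * L)
      rwa [add_zero] at this
    have hwin : ∫⁻ τ in Ioo 0 L, eGradNormSq (v j ((n : ℝ) * L + τ)) ≤ ENNReal.ofReal (1 * (1 + L)) :=
      calc ∫⁻ τ in Ioo 0 L, eGradNormSq (v j ((n : ℝ) * L + τ))
          = ∫⁻ τ in Ioo ((n : ℝ) * L) ((n : ℝ) * L + L), G τ := e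
        _ ≤ ∫⁻ τ in Ioc ((n : ℝ) * L) (((n : ℝ) + 1) * L), G τ :=
            lintegral_mono_set (by rw [add_one_mul]; exact Ioo_subset_Ioc_self)
        _ ≤ 1 := hle
        _ ≤ ENNReal.ofReal (1 * (1 + L)) := by
            rw [one_mul, ← ENNReal.ofReal_one]; exact ENNReal.ofReal_le_ofReal (by linarith)
    exact absurd hwin (not_le.2 (hcon ((n : ℝ) * L) (by positivity)))
  have hgrow : ∀ n : ℕ, (n : ℝ≥0∞) ≤ ∫⁻ τ in Ioc 0 ((n : ℝ) * L), G τ := by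
    intro n
    induction n with
    | zero => simp
    | succ n ih =>
      push_cast
      rw [hsplit n]
      exact add_le_add ih (hbig n).le
  have hNQ : (N : ℝ≥0∞) ≤ ENNReal.ofReal Q := (hgrow N).trans (hcum N (Nat.succ_pos _))
  rw [← ENNReal.ofReal_natCast, ENNReal.ofReal_le_ofReal_iff hQ0] at hNQ
  have : Q < N := by rw [hN]; push_cast; exact Nat.lt_floor_add_one Q
  linarith

/-- **`RelaxingFamily` (crux r3) is false for the zero force** (unconditional): freely decaying planar
turbulence, however pre-stirred its data, cannot relax a profile `ν`-uniformly from every phase — late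
windows are quasi-laminar. [cite: Seis2022, Remark 1 (arXiv:2003.08794 p. 4)] -/
theorem relaxingFamily_false_with_zero_force :
    ¬ RelaxingFamilyUnder (fun g _ _ _ => g = 0) := by
  rintro ⟨g, h, hg, hgd, hgm, hh, hhm, hh0, ν, v₀, v, hν, hνlim, hLH, hbd, hE, rfl, hrest⟩
  exact relaxingFamily_false_with_quasiLaminarWindows
    ⟨0, h, hg, hgd, hgm, hh, hhm, hh0, ν, v₀, v, hν, hνlim, hLH, hbd, hE,
      quasiLaminarWindows_of_unforced hν hLH, hrest⟩

/-- **X is false for the zero force** (unconditional): the steady force of an X-witness is nonzero.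
[cite: Seis2022, Remark 1 (arXiv:2003.08794 p. 4)] -/
theorem uniformRelaxationWitness_false_with_zero_force :
    ¬ UniformRelaxationWitnessUnder (fun g _ _ _ => g = 0) := fun hX =>
  relaxingFamily_false_with_zero_force hX.relaxingFamilyUnder

/-! # Near-misses (sorried; obstruction in the docstring) and the open kill -/

/-- Planar curl `∂₁g₂ − ∂₂g₁` (source of the vorticity equation at `Pr = 1`). -/
def planarCurl (g : 𝕋² → E²) (x : 𝕋²) : ℝ :=
  Torus.partialDeriv 0 (fun y => g y 1) x - Torus.partialDeriv 1 (fun y => g y 0) x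

/-- **NEAR-MISS (ideator 1, N1: no universal relaxer).** An X-witness cannot ALSO relax the profile
`curl g` phase-uniformly and `ν`-uniformly: `ω_j = curl v_j` solves the `curl g`-sourced scalar equation
with diffusivity `ν_j` (Pr = 1), so (U_{curl g}) + the Duhamel inventory bound (the route's PROVED
`relaxationBoundsInventory_proof`, applied to `ω_j` after the free decay of `ω_j(s)`) caps the windowed mean
enstrophy uniformly in `j`, and Part C fires. OBSTRUCTION: the tree has no vorticity formulation of planar
Leray–Hopf solutions in the weak scalar class `IsWeakScalarTransportForced` (`ω_j ∈ L^∞_t L²_x`), on paper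
classical. Consequence for ideators: every 'universal mixer' transplant is dead as a model of an NS witness;
witnesses remember `curl g` for `≳ log(1/ν_j)` while forgetting `h` in `O(1/γ)`. -/
theorem noUniversalRelaxer :
    ¬ UniformRelaxationWitnessUnder (fun g _ ν v =>
      ∃ C' γ' : ℝ, 0 ≤ C' ∧ 0 < γ' ∧ RelaxesUniformly ν v (planarCurl g) C' γ') := by
  sorry

/-- **NEAR-MISS (data must be pre-stirred).** No X-witness has data bounded in `L² ∩ H¹` uniformly in
`j`: (U_h) is demanded from phase `s = 0`, and on the FIXED window `[0, (N+1)/D + 2]` of Part C the 2-D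
enstrophy balance `½‖∇v(t)‖² ≤ ½‖∇v₀‖² − ∫₀ᵗ⟨Δg, v⟩ ≤ ½‖∇v₀‖² + t‖Δg‖₂(‖v₀‖₂ + 2t‖g‖₂)` bounds the
windowed strain uniformly in `j`. OBSTRUCTION: the tree proves this inequality along Galerkin approximants
(`steady_galerkin_enstrophy_le`) and transfers only its dissipation part to Leray–Hopf solutions
(`lions_prodi_uniqueness_torus2.enstrophyIneq`); the pointwise term needs the lower-semicontinuity step. -/
theorem preStirredData :
    ¬ UniformRelaxationWitnessUnder (fun _ _ _ v => ∃ R : ℝ, ∀ j,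
      (∫ x, ‖v j 0 x‖ ^ 2) ≤ R ∧ (eGradNormSq (v j 0)).toReal ≤ R ∧ eGradNormSq (v j 0) ≠ ⊤) := by
  sorry

/-- **THE KILL (open; why it resists — see the module docstring).** `¬X` ⇐ a `j`-uniform windowed strain
budget (Part C's `WindowedStrainBudget`) for EVERY bounded-energy steadily forced planar Leray–Hopf family.
Available: `⟨‖∇v_j‖²⟩ ≲ ν_j^{-1/2}`; `ν`-uniform budgets only at the `L¹`/`LlogL` vorticity level, where
Seis-type floors stop (Bressan's conjecture); needed: `o(log(1/ν_j))` windowed strain or a `p = 1` floor. -/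
theorem not_uniformRelaxationWitness : ¬ UniformRelaxationWitness := by
  sorry

end Summit.AnomalousDissipation.AnomalousDissipation.Cruxes.UniformRelaxationWitness.Disproof

end
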